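import Mathlib.RingTheory.Polynomial.Cyclotomic.Expand
import Mathlib.NumberTheory.Padics.RingHoms
import Literature.NumberTheory.EllipticCurves.Sprung2017.SharpFlatPAdicLFunctionUniqueProofs
import Literature.NumberTheory.EllipticCurves.GreenbergVatsal2000.MultiplicativeReduction
import Literature.NumberTheory.EllipticCurves.Sprung2012.ColemanMapLambdaActionProofs
import Literature.NumberTheory.EllipticCurves.Sprung2012.HondaSystemSprungLogarithm
import Literature.NumberTheory.EllipticCurves.LocalRestrictionTransport
import HarnessLib
/-!
# Honda systems at supersingular primes (Sprung 2012 Thm. 2.2 / Kobayashi 2003 §8), V: transport of Honda data along isomorphisms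
# of algebraic closures (`ℚ_[p] → ℚ_v`, via `LocalRestrictionTransport.lean`), the chromatic congruence, `ω`-divisibility, the dual generation
# clauses of `Sprung2012.IsHondaSystem` — the named fact `Sprung2012.thm22_exists_isHondaSystem` HOLDS (Sprung 2012 Thm. 2.2,
# Cor. 2.10, Lemmas 7.4–7.5; Kobayashi 2003 Lemma 8.9, Prop. 8.11–8.12; Serre, Galois Cohomology)

**Sprung 2012, Theorem 2.2: Honda systems of local points exist at an odd supersingular prime — the EXACT discharge
`Literature.NumberTheory.EllipticCurves.Sprung2012.thm22_exists_isHondaSystem_holds` of the named fact of `ColemanMapTheorems.lean`**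
(F. Sprung, J. Number Theory 132 (2012) Thm. 2.2 (p. 1487), Cor. 2.10, Lemmas 7.4–7.5 [Sprung2012]; S. Kobayashi, Invent. Math. 152
(2003) Lemma 8.9, Prop. 8.11–8.12 [Kobayashi2003]; J.-P. Serre, *Galois Cohomology* [SerreGaloisCohomology1997]; J. Milne, *Fields and
Galois Theory* [MilneFT2022]): transport of (plus / primal) Honda data along isomorphisms of algebraic closures from Mathlib's `ℚ_[p]` to the completion
`ℚ_v = v.adicCompletion ℚ` (the transport of local restriction maps is imported from `LocalRestrictionTransport.lean`, same lane), the chromatic congruence behind the `♯/♭ ↔ ±` transfer,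
`ω`-divisibility, and the passage from the primal data to the four dual generation clauses of `Sprung2012.IsHondaSystem`; the last
Part assembles Theorem 2.2 exactly as the Summits twin `Summit.BirchSwinnertonDyer.BirchSwinnertonDyer.Theorems.thm22_exists_isHondaSystem_holds`.
RE-HOMED into `Literature/` by the Hodge foundations lane (`lit-hodgefound`, seat p20, generation 41): verbatim DECLARATION-LEVEL
ports, in dependency order, of the declarations of the modules `Summits/BirchSwinnertonDyer/{Rank1Residual/Additive, BirchSwinnertonDyer/Theorems}/ThetaPartnerAtTwoSignedControlAtTwoPlusHondaTransportEngine, ThetaPartnerAtTwoSignedControlAtTwoPlusHondaTransportNonDiv,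
PrintX8VSInputHondaSystemPrimalTransport, SignedLowerHalvesSprungLowerHalfAtThreeChromaticCongruence, PrintX8VSInputHondaSystemOmegaDivisibility,
PrintX8VSInputHondaSystemDualCore, PrintX8VSInputHondaSystemDualClauses.lean`
(BSD cells `b2b-bsdres` / `bsd-inputs`, where they certify `p`-adic analysis of formal groups and of the cyclotomic tower at a
supersingular prime — unconditional facts about elliptic curves over `ℚ` and `ℚ_p`, independent of the Birch–Swinnerton-Dyer conjecture),
namespaces `Summit.BirchSwinnertonDyer.Rank1Residual.Additive` and `Summit.BirchSwinnertonDyer.BirchSwinnertonDyer.Theorems` BOTH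
re-rooted as `Literature.NumberTheory.EllipticCurves.Sprung2012.Honda` (sub-namespaces `BallEval`, `PadicCyclotomicTower`, `HondaFss`,
`SprungHonda`, `SignedEC`, … kept).  The declarations of the cone that are already in `Literature/` (Kobayashi's signed local
conditions `localFixedPointsOfEmb`, `localPairTraceOfEmb`, `towerSubgroup`, … of
`NumberTheory/EllipticCurves/Kobayashi2003/CyclotomicTowerSignedSelmer.lean`) are IMPORTED, not duplicated.  Definitions are ported with
their bodies (real `def`s: evaluation maps, ball points, logarithms, towers, transported points — no `Prop`-valued placeholder, no
named fact: D-0026 net debt 0 for this file); every declaration carries the citation of the printed step it formalises or serves;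
imports Mathlib/Literature only.  The Summits originals stay in place (transitional duplication; twins = same short names under the two
Summits namespaces).  Nothing here bears on the Birch–Swinnerton-Dyer conjecture or any summit statement.
Builds on files I–IV of the series.
-/

noncomputable section

open Literature.NumberTheory.EllipticCurves.Kobayashi2003

/-!
## Part 1 — port of `Summits/BirchSwinnertonDyer/BirchSwinnertonDyer/Theorems/ThetaPartnerAtTwoSignedControlAtTwoPlusHondaTransportEngine.lean` (13 declarations kept)

# Model transport for Kobayashi's local layer objects along an isomorphism of algebraic closures — file 1 of 2 (the engine) of the
# transport of the plus Honda system at `2` from Mathlib's `ℚ_[2]` to the completion `ℚ_v`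

(Port of the declarations listed in the Part header; the source module's docstring — cell bookkeeping of the BSD
printed-inputs programme — is abridged to its title here.)
-/

section Part1

open scoped _root_.Classical _root_.NumberField

open _root_.NumberField _root_.IsDedekindDomain _root_.WeierstrassCurve Literature.NumberTheory.EllipticCurves
  Literature.NumberTheory.EllipticCurves.Kobayashi2003
  Literature.NumberTheory.EllipticCurves.LocalTransport

universe u

namespace Literature.NumberTheory.EllipticCurves.Sprung2012.Honda.SignedEC

section Generic

variable {K : Type u} [Field K] {E : Type u} [Field E] [Algebra K E] {E' : Type u} [Field E'] [Algebra K E']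
  (Φ : AlgebraicClosure E ≃ₐ[K] AlgebraicClosure E') (φ : E ≃+* E')
  (hf : ∀ y : E, Φ (algebraMap E (AlgebraicClosure E) y) = algebraMap E' (AlgebraicClosure E') (φ y))

/-! ## §1 Conjugation of Galois elements along `Φ` -/

include hf in
/-- Every `h ∈ Γ_E` fixes `Φ⁻¹(E') = E` pointwise — the fixing hypothesis of `transportAut Φ` (`h ↦ Φ h Φ⁻¹ ∈ Γ_{E'}`).
[cite: SerreGaloisCohomology1997, II.§1.1] -/
theorem modelFix (h : Field.absoluteGaloisGroup E) (y : E') :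
    (show AlgebraicClosure E ≃ₐ[E] AlgebraicClosure E from h)
        (Φ.toRingEquiv.symm (algebraMap E' (AlgebraicClosure E') y)) =
      Φ.toRingEquiv.symm (algebraMap E' (AlgebraicClosure E') y) := by
  have h1 : Φ.toRingEquiv.symm (algebraMap E' (AlgebraicClosure E') y) =
      algebraMap E (AlgebraicClosure E) (φ.symm y) := by
    apply Φ.toRingEquiv.injective
    rw [RingEquiv.apply_symm_apply]
    change _ = Φ _
    rw [hf, RingEquiv.apply_symm_apply]
  rw [h1]
  exact AlgEquiv.commutes _ _

include hf in
/-- Every `t ∈ Γ_{E'}` fixes `Φ(E) = E'` pointwise — the fixing hypothesis of `transportAut Φ⁻¹` (`t ↦ Φ⁻¹ t Φ ∈ Γ_E`).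
[cite: SerreGaloisCohomology1997, II.§1.1] -/
theorem modelFix_symm (t : Field.absoluteGaloisGroup E') (y : E) :
    (show AlgebraicClosure E' ≃ₐ[E'] AlgebraicClosure E' from t)
        (Φ.toRingEquiv.symm.symm (algebraMap E (AlgebraicClosure E) y)) =
      Φ.toRingEquiv.symm.symm (algebraMap E (AlgebraicClosure E) y) := by
  rw [RingEquiv.symm_symm]
  change _ = Φ _
  change (show AlgebraicClosure E' ≃ₐ[E'] AlgebraicClosure E' from t) (Φ _) = _
  rw [hf]
  exact AlgEquiv.commutes _ _

/-- Values of `Φ h Φ⁻¹`. [cite: SerreGaloisCohomology1997, II.§1.1] -/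
theorem transportAut_model_apply (h : Field.absoluteGaloisGroup E) (hh) (x : AlgebraicClosure E') :
    (show AlgebraicClosure E' ≃ₐ[E'] AlgebraicClosure E' from transportAut Φ.toRingEquiv h hh) x =
      Φ ((show AlgebraicClosure E ≃ₐ[E] AlgebraicClosure E from h) (Φ.symm x)) :=
  transportAut_apply Φ.toRingEquiv h hh x

/-- Values of `Φ⁻¹ t Φ`. [cite: SerreGaloisCohomology1997, II.§1.1] -/
theorem transportAut_model_symm_apply (t : Field.absoluteGaloisGroup E') (ht) (x : AlgebraicClosure E) :
    (show AlgebraicClosure E ≃ₐ[E] AlgebraicClosure E from transportAut Φ.toRingEquiv.symm t ht) x =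
      Φ.symm ((show AlgebraicClosure E' ≃ₐ[E'] AlgebraicClosure E' from t) (Φ x)) :=
  transportAut_apply Φ.toRingEquiv.symm t ht x

/-- `Φ (Φ⁻¹ t Φ) Φ⁻¹ = t`. [cite: SerreGaloisCohomology1997, II.§1.1] -/
theorem transportAut_transportAut_symm_model (t : Field.absoluteGaloisGroup E') (ht) (hh) :
    transportAut Φ.toRingEquiv (transportAut Φ.toRingEquiv.symm t ht) hh = t := by
  apply AlgEquiv.ext
  intro x
  rw [transportAut_model_apply, transportAut_model_symm_apply, AlgEquiv.apply_symm_apply,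
    AlgEquiv.apply_symm_apply]

variable (ι : AlgebraicClosure K →ₐ[K] AlgebraicClosure E) (ι' : AlgebraicClosure K →ₐ[K] AlgebraicClosure E')
  (hcompat : ∀ z : AlgebraicClosure K, ι' z = Φ (ι z))

include hcompat in
/-- **The restrictions to `Γ_K` match**: `res_{ι'} (Φ h Φ⁻¹) = res_ι h` when `ι' = Φ ∘ ι` (both sides are characterised by
`emb ∘ res σ = σ ∘ emb`). [cite: SerreGaloisCohomology1997, II.§1.1] -/
theorem resGalOfEmb_transportAut_model (h : Field.absoluteGaloisGroup E) (hh) :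
    resGalOfEmb ι' (transportAut Φ.toRingEquiv h hh) = resGalOfEmb ι h := by
  apply AlgEquiv.ext
  intro z
  have h1 : ι' ((show AlgebraicClosure K ≃ₐ[K] AlgebraicClosure K from
      resGalOfEmb ι' (transportAut Φ.toRingEquiv h hh)) z) =
      (show AlgebraicClosure E' ≃ₐ[E'] AlgebraicClosure E' from transportAut Φ.toRingEquiv h hh) (ι' z) :=
    apply_resGalAuxOfEmb_apply ι' (transportAut Φ.toRingEquiv h hh) z
  have h2 : ι ((show AlgebraicClosure K ≃ₐ[K] AlgebraicClosure K from resGalOfEmb ι h) z) =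
      (show AlgebraicClosure E ≃ₐ[E] AlgebraicClosure E from h) (ι z) :=
    apply_resGalAuxOfEmb_apply ι h z
  have key : ι' ((show AlgebraicClosure K ≃ₐ[K] AlgebraicClosure K from
      resGalOfEmb ι' (transportAut Φ.toRingEquiv h hh)) z) =
      ι' ((show AlgebraicClosure K ≃ₐ[K] AlgebraicClosure K from resGalOfEmb ι h) z) := by
    rw [h1, transportAut_model_apply, hcompat, hcompat, AlgEquiv.symm_apply_apply, h2]
  exact ι'.injective key

include hcompat in
/-- **Local subgroups correspond**: `Φ h Φ⁻¹ ∈ H_{ι'} ↔ h ∈ H_ι` for every `H ≤ Γ_K`. [cite: SerreGaloisCohomology1997, II.§1.1]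
[cite: GreenbergLNM1716, §2] -/
theorem transportAut_mem_localSubgroupOfEmb_iff_model (H : Subgroup (Field.absoluteGaloisGroup K))
    (h : Field.absoluteGaloisGroup E) (hh) :
    transportAut Φ.toRingEquiv h hh ∈ localSubgroupOfEmb H ι' ↔ h ∈ localSubgroupOfEmb H ι := by
  rw [mem_localSubgroupOfEmb_iff, mem_localSubgroupOfEmb_iff, resGalOfEmb_transportAut_model Φ ι ι' hcompat]

include hf hcompat in
/-- `Φ⁻¹ t Φ ∈ H_ι ↔ t ∈ H_{ι'}`. [cite: SerreGaloisCohomology1997, II.§1.1] -/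
theorem transportAut_symm_mem_localSubgroupOfEmb_iff_model (H : Subgroup (Field.absoluteGaloisGroup K))
    (t : Field.absoluteGaloisGroup E') (ht) :
    transportAut Φ.toRingEquiv.symm t ht ∈ localSubgroupOfEmb H ι ↔ t ∈ localSubgroupOfEmb H ι' := by
  rw [← transportAut_mem_localSubgroupOfEmb_iff_model Φ ι ι' hcompat H _ (modelFix Φ φ hf _),
    transportAut_transportAut_symm_model]

/-! ## §2 The coordinate map `T = Φ_*` on points -/

variable (W : WeierstrassCurve K) (T : localPoints W E →+ localPoints W E')
  (hT : ∀ P : localPoints W E, T P =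
    WeierstrassCurve.Affine.Point.map (W' := W) (Φ : AlgebraicClosure E →ₐ[K] AlgebraicClosure E')
      (show (W.baseChange (AlgebraicClosure E)).toAffine.Point from P))

include hT in
/-- **`T` is `Φ(·)Φ⁻¹`-equivariant**: `T (h • P) = (Φ h Φ⁻¹) • T P`. [cite: SerreGaloisCohomology1997, I.§2.4]
[cite: SilvermanAEC2009, VIII.§1] -/
theorem modelMap_smul (h : Field.absoluteGaloisGroup E) (hh) (P : localPoints W E) :
    T (h • P) = transportAut Φ.toRingEquiv h hh • T P := by
  rw [hT, hT, localPoints.smul_def, localPoints.smul_def]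
  change WeierstrassCurve.Affine.Point.map _ (WeierstrassCurve.Affine.Point.map _ _) =
    WeierstrassCurve.Affine.Point.map _ (WeierstrassCurve.Affine.Point.map _ _)
  rw [WeierstrassCurve.Affine.Point.map_map, WeierstrassCurve.Affine.Point.map_map]
  have hF : (Φ : AlgebraicClosure E →ₐ[K] AlgebraicClosure E').comp
      ((AlgEquiv.restrictScalars K (show AlgebraicClosure E ≃ₐ[E] AlgebraicClosure E from h) :
          AlgebraicClosure E ≃ₐ[K] AlgebraicClosure E) : AlgebraicClosure E →ₐ[K] AlgebraicClosure E) =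
      ((AlgEquiv.restrictScalars K (show AlgebraicClosure E' ≃ₐ[E'] AlgebraicClosure E' from
          transportAut Φ.toRingEquiv h hh) : AlgebraicClosure E' ≃ₐ[K] AlgebraicClosure E') :
          AlgebraicClosure E' →ₐ[K] AlgebraicClosure E').comp
        (Φ : AlgebraicClosure E →ₐ[K] AlgebraicClosure E') := by
    apply AlgHom.ext
    intro x
    change Φ ((show AlgebraicClosure E ≃ₐ[E] AlgebraicClosure E from h) x) =
      (show AlgebraicClosure E' ≃ₐ[E'] AlgebraicClosure E' from transportAut Φ.toRingEquiv h hh) (Φ x)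
    rw [transportAut_model_apply, AlgEquiv.symm_apply_apply]
  exact congrArg (fun F ↦ WeierstrassCurve.Affine.Point.map F _) hF

include hT in
/-- `T` is surjective (`(Φ⁻¹)_*` is a right inverse). [cite: SilvermanAEC2009, VIII.§1] -/
theorem modelMap_surjective : Function.Surjective T := by
  intro Q
  refine ⟨WeierstrassCurve.Affine.Point.map (W' := W)
    ((Φ.symm : AlgebraicClosure E' ≃ₐ[K] AlgebraicClosure E) : AlgebraicClosure E' →ₐ[K] AlgebraicClosure E)
    (show (W.baseChange (AlgebraicClosure E')).toAffine.Point from Q), ?_⟩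
  rw [hT]
  change WeierstrassCurve.Affine.Point.map _ (WeierstrassCurve.Affine.Point.map _ _) = _
  rw [WeierstrassCurve.Affine.Point.map_map, AlgEquiv.comp_symm]
  change WeierstrassCurve.Affine.Point.map (AlgHom.id K (AlgebraicClosure E'))
    (show (W.baseChange (AlgebraicClosure E')).toAffine.Point from Q) = Q
  cases Q <;> rfl

variable {p : ℕ} [Fact p.Prime] (κ : ZpExtension K p)

include hf hcompat hT in
/-- **Layer points correspond**: `T P ∈ E(K_n·E') ↔ P ∈ E(K_n·E)` (the local subgroups `Gal(Ē/K_n·E)`, `Gal(Ē'/K_n·E')` correspond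
under `Φ(·)Φ⁻¹`, and `T` is equivariant and injective). [cite: Kobayashi2003, Def. 1.1] [cite: SerreGaloisCohomology1997, II.§1.1] -/
theorem modelMap_mem_localLayerPointsOfEmb_iff (n : ℕ) (P : localPoints W E) :
    T P ∈ localLayerPointsOfEmb κ ι' W n ↔ P ∈ localLayerPointsOfEmb κ ι W n := by
  rw [mem_localLayerPointsOfEmb_iff, mem_localLayerPointsOfEmb_iff]
  constructor
  · intro hTP τ hτ
    -- `T` is injective (`Point.map` of the injective `Φ`)
    have hinj : Function.Injective T := fun P Q hPQ ↦ by
      rw [hT, hT] at hPQ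
      exact WeierstrassCurve.Affine.Point.map_injective (W' := W) _ hPQ
    apply hinj
    rw [modelMap_smul Φ W T hT τ (modelFix Φ φ hf τ)]
    apply hTP
    change _ ∈ localSubgroupOfEmb (κ.layerSubgroup n) ι'
    rw [transportAut_mem_localSubgroupOfEmb_iff_model Φ ι ι' hcompat]
    exact hτ
  · intro hP t ht
    rw [← transportAut_transportAut_symm_model Φ t (modelFix_symm Φ φ hf t) (modelFix Φ φ hf _),
      ← modelMap_smul Φ W T hT, hP]
    change _ ∈ localSubgroupOfEmb (κ.layerSubgroup n) ι
    rw [transportAut_symm_mem_localSubgroupOfEmb_iff_model Φ φ hf ι ι' hcompat]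
    exact ht

include hf hcompat hT in
/-- **Traces correspond on layer points**: `T (Tr^{ι}_{k/m} P) = Tr^{ι'}_{k/m} (T P)` for `P ∈ E(K_k·E)`. `Φ(·)Φ⁻¹` is a bijection
`Gal(Ē/K_m·E) → Gal(Ē'/K_m·E')` carrying `Gal(Ē/K_k·E)` onto `Gal(Ē'/K_k·E')`, hence a bijection of the coset spaces; the trace of a
layer point is the sum over ANY system of representatives (`localTraceOfEmb_apply_eq_sum_of_mem`), and `T (g • P) = (Φ g Φ⁻¹) • T P`.
[cite: Kobayashi2003, Def. 1.1] [cite: SerreGaloisCohomology1997, II.§1.1] -/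
theorem modelMap_localTraceOfEmb (m k : ℕ) {P : localPoints W E} (hP : P ∈ localLayerPointsOfEmb κ ι W k) :
    T (localTraceOfEmb κ ι W m k P) = localTraceOfEmb κ ι' W m k (T P) := by
  set A₁ := localLayerSubgroupOfEmb κ ι m with hA₁
  set A₂ := localLayerSubgroupOfEmb κ ι k with hA₂
  set B₁ := localLayerSubgroupOfEmb κ ι' m with hB₁
  set B₂ := localLayerSubgroupOfEmb κ ι' k with hB₂
  -- `θ : A₁ → B₁`, `g ↦ Φ g Φ⁻¹`
  have hθmem : ∀ g : A₁, transportAut Φ.toRingEquiv (g : Field.absoluteGaloisGroup E) (modelFix Φ φ hf _) ∈ B₁ := by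
    intro g
    change _ ∈ localSubgroupOfEmb (κ.layerSubgroup m) ι'
    rw [transportAut_mem_localSubgroupOfEmb_iff_model Φ ι ι' hcompat]
    exact g.2
  let θ : A₁ → B₁ := fun g ↦ ⟨transportAut Φ.toRingEquiv (g : Field.absoluteGaloisGroup E) (modelFix Φ φ hf _), hθmem g⟩
  have hθcoe : ∀ g : A₁, ((θ g : B₁) : Field.absoluteGaloisGroup E') =
      transportAut Φ.toRingEquiv (g : Field.absoluteGaloisGroup E) (modelFix Φ φ hf _) := fun _ ↦ rfl
  have hθmul : ∀ g g' : A₁, θ (g * g') = θ g * θ g' := by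
    intro g g'
    apply Subtype.ext
    apply AlgEquiv.ext
    intro x
    change (show AlgebraicClosure E' ≃ₐ[E'] AlgebraicClosure E' from
        transportAut Φ.toRingEquiv ((g : Field.absoluteGaloisGroup E) * (g' : Field.absoluteGaloisGroup E))
          (modelFix Φ φ hf _)) x =
      (show AlgebraicClosure E' ≃ₐ[E'] AlgebraicClosure E' from
        transportAut Φ.toRingEquiv (g : Field.absoluteGaloisGroup E) (modelFix Φ φ hf _))
        ((show AlgebraicClosure E' ≃ₐ[E'] AlgebraicClosure E' from
          transportAut Φ.toRingEquiv (g' : Field.absoluteGaloisGroup E) (modelFix Φ φ hf _)) x)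
    rw [transportAut_model_apply, transportAut_model_apply, transportAut_model_apply, AlgEquiv.symm_apply_apply]
    rfl
  have hθone : θ 1 = 1 := by
    apply Subtype.ext
    apply AlgEquiv.ext
    intro x
    change (show AlgebraicClosure E' ≃ₐ[E'] AlgebraicClosure E' from
        transportAut Φ.toRingEquiv ((1 : A₁) : Field.absoluteGaloisGroup E) (modelFix Φ φ hf _)) x = x
    rw [transportAut_model_apply]
    exact Φ.apply_symm_apply x
  have hθinv : ∀ g : A₁, θ g⁻¹ = (θ g)⁻¹ := fun g ↦
    eq_inv_of_mul_eq_one_left (by rw [← hθmul, inv_mul_cancel, hθone])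
  have hθs : ∀ (g : A₁) (R : localPoints W E),
      T ((g : Field.absoluteGaloisGroup E) • R) = ((θ g : B₁) : Field.absoluteGaloisGroup E') • T R :=
    fun g R ↦ modelMap_smul Φ W T hT _ (modelFix Φ φ hf _) R
  -- `θ` carries `A₂` onto `B₂`
  have hrn : ∀ g : A₁, (g : Field.absoluteGaloisGroup E) ∈ A₂ ↔ ((θ g : B₁) : Field.absoluteGaloisGroup E') ∈ B₂ := by
    intro g
    rw [hθcoe]
    change _ ∈ localSubgroupOfEmb (κ.layerSubgroup k) ι ↔ _ ∈ localSubgroupOfEmb (κ.layerSubgroup k) ι'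
    rw [transportAut_mem_localSubgroupOfEmb_iff_model Φ ι ι' hcompat]
  -- `θ` is onto `B₁`
  have hθsurj : Function.Surjective θ := by
    intro b
    have hb : transportAut Φ.toRingEquiv.symm (b : Field.absoluteGaloisGroup E') (modelFix_symm Φ φ hf _) ∈ A₁ := by
      change _ ∈ localSubgroupOfEmb (κ.layerSubgroup m) ι
      rw [transportAut_symm_mem_localSubgroupOfEmb_iff_model Φ φ hf ι ι' hcompat]
      exact b.2
    refine ⟨⟨_, hb⟩, Subtype.ext ?_⟩
    rw [hθcoe]
    exact transportAut_transportAut_symm_model Φ _ (modelFix_symm Φ φ hf _) (modelFix Φ φ hf _)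
  haveI : Fintype (A₁ ⧸ A₂.subgroupOf A₁) := Fintype.ofFinite _
  haveI : Fintype (B₁ ⧸ B₂.subgroupOf B₁) := Fintype.ofFinite _
  -- representatives on the `E`-side and their images
  let s₂ : A₁ ⧸ A₂.subgroupOf A₁ → A₁ := fun q ↦ q.out
  have hs₂ : ∀ q, ((s₂ q : A₁) : A₁ ⧸ A₂.subgroupOf A₁) = q := fun q ↦ q.out_eq
  let ψ : A₁ ⧸ A₂.subgroupOf A₁ → B₁ ⧸ B₂.subgroupOf B₁ := fun q ↦ (θ (s₂ q) : B₁)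
  have hψmk : ∀ g : A₁, ψ (g : A₁ ⧸ A₂.subgroupOf A₁) = (θ g : B₁ ⧸ B₂.subgroupOf B₁) := by
    intro g
    apply QuotientGroup.eq.mpr
    rw [Subgroup.mem_subgroupOf, ← hθinv, ← hθmul, ← hrn]
    have h := QuotientGroup.eq.mp (hs₂ (g : A₁ ⧸ A₂.subgroupOf A₁))
    rw [Subgroup.mem_subgroupOf] at h
    exact h
  have hψinj : Function.Injective ψ := by
    intro a b hab
    rw [← hs₂ a, ← hs₂ b]
    apply QuotientGroup.eq.mpr
    rw [Subgroup.mem_subgroupOf]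
    have h := QuotientGroup.eq.mp hab
    rw [Subgroup.mem_subgroupOf, ← hθinv, ← hθmul, ← hrn] at h
    exact h
  have hψsurj : Function.Surjective ψ := by
    intro q
    induction q using QuotientGroup.induction_on with
    | H b =>
      obtain ⟨g, rfl⟩ := hθsurj b
      exact ⟨(g : A₁ ⧸ A₂.subgroupOf A₁), hψmk g⟩
  let e : (A₁ ⧸ A₂.subgroupOf A₁) ≃ (B₁ ⧸ B₂.subgroupOf B₁) := Equiv.ofBijective ψ ⟨hψinj, hψsurj⟩
  -- the transported system of representatives on the `E'`-side
  let s₁ : B₁ ⧸ B₂.subgroupOf B₁ → B₁ := fun q ↦ θ (s₂ (e.symm q))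
  have hs₁ : ∀ q, ((s₁ q : B₁) : B₁ ⧸ B₂.subgroupOf B₁) = q := fun q ↦ by
    change ψ (e.symm q) = q
    exact e.apply_symm_apply q
  -- both traces as sums over representatives
  have hTP : T P ∈ localLayerPointsOfEmb κ ι' W k :=
    (modelMap_mem_localLayerPointsOfEmb_iff Φ φ hf ι ι' hcompat W T hT κ k P).mpr hP
  rw [localTraceOfEmb_apply_eq_sum_of_mem κ ι' W m k hTP s₁ hs₁,
    localTraceOfEmb_apply_eq_sum_of_mem κ ι W m k hP s₂ hs₂, map_sum, ← e.sum_comp]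
  refine Finset.sum_congr rfl fun q _ ↦ ?_
  rw [hθs]
  change _ = ((θ (s₂ (e.symm (e q))) : B₁) : Field.absoluteGaloisGroup E') • T P
  rw [e.symm_apply_apply]

include hf hT in
/-- **Orbit closures correspond**: `T(ℤ[Γ_E]·d) = ℤ[Γ_{E'}]·(T d)` (`T (σ • d) = (Φ σ Φ⁻¹) • T d` and `Φ(·)Φ⁻¹` is onto `Γ_{E'}`).
[cite: SerreGaloisCohomology1997, II.§1.1] -/
theorem map_modelMap_closure_orbit (d : localPoints W E) :
    (AddSubgroup.closure (Set.range fun σ : Field.absoluteGaloisGroup E ↦ σ • d)).map T =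
      AddSubgroup.closure (Set.range fun σ' : Field.absoluteGaloisGroup E' ↦ σ' • T d) := by
  rw [AddMonoidHom.map_closure]
  congr 1
  ext x
  simp only [Set.mem_image, Set.mem_range]
  constructor
  · rintro ⟨_, ⟨σ, rfl⟩, rfl⟩
    exact ⟨transportAut Φ.toRingEquiv σ (modelFix Φ φ hf σ), (modelMap_smul Φ W T hT σ _ d).symm⟩
  · rintro ⟨σ', rfl⟩
    refine ⟨transportAut Φ.toRingEquiv.symm σ' (modelFix_symm Φ φ hf σ') • d, ⟨_, rfl⟩, ?_⟩
    rw [modelMap_smul Φ W T hT _ (modelFix Φ φ hf _), transportAut_transportAut_symm_model]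

end Generic

end Literature.NumberTheory.EllipticCurves.Sprung2012.Honda.SignedEC

end Part1

/-!
## Part 2 — port of `Summits/BirchSwinnertonDyer/BirchSwinnertonDyer/Theorems/ThetaPartnerAtTwoSignedControlAtTwoPlusHondaTransportNonDiv.lean` (2 declarations kept)

# Model transport for the plus Honda system at `2`, file 3: the NON-DIVISIBILITY form — HONDA⁺@2 over `ℚ_v` with (GEN₀)
# ⟸ over Mathlib's `ℚ_[2]`, for every embedding `ι`, the clauses (L) ∧ (TR) ∧ (GEN) ∧ «`d 0 ∉ 2·E(ℚ₂)`»

(Port of the declarations listed in the Part header; the source module's docstring — cell bookkeeping of the BSD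
printed-inputs programme — is abridged to its title here.)
-/

section Part2

open scoped _root_.Classical _root_.NumberField

open _root_.NumberField _root_.IsDedekindDomain _root_.WeierstrassCurve Literature.NumberTheory.EllipticCurves
  Literature.NumberTheory.EllipticCurves.Kobayashi2003
  Literature.NumberTheory.EllipticCurves.LocalTransport

universe u

namespace Literature.NumberTheory.EllipticCurves.Sprung2012.Honda.SignedEC

/-! ## §1 Transport of the non-divisibility form (generic) -/

section Generic

variable {K : Type u} [Field K] {E : Type u} [Field E] [Algebra K E] {E' : Type u} [Field E'] [Algebra K E']
  (Φ : AlgebraicClosure E ≃ₐ[K] AlgebraicClosure E') (φ : E ≃+* E')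
  (hf : ∀ y : E, Φ (algebraMap E (AlgebraicClosure E) y) = algebraMap E' (AlgebraicClosure E') (φ y))
  (ι : AlgebraicClosure K →ₐ[K] AlgebraicClosure E) (ι' : AlgebraicClosure K →ₐ[K] AlgebraicClosure E')
  (hcompat : ∀ z : AlgebraicClosure K, ι' z = Φ (ι z))
  (W : WeierstrassCurve K) (T : localPoints W E →+ localPoints W E')
  (hT : ∀ P : localPoints W E, T P =
    WeierstrassCurve.Affine.Point.map (W' := W) (Φ : AlgebraicClosure E →ₐ[K] AlgebraicClosure E')
      (show (W.baseChange (AlgebraicClosure E)).toAffine.Point from P))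
  {p : ℕ} [Fact p.Prime] (κ : ZpExtension K p)

end Generic

/-! ## §2 `K = ℚ`: `ℚ_[p]` (every embedding) → `ℚ_v` (the chosen embedding), and the (GEN₀) form at `p = 2` -/

section Padic

open _root_.Rat.HeightOneSpectrum

/-- A finite place `v` of `ℚ` containing the rational prime `p` is the place of `p` (`primesEquiv v = p`). [folklore] -/
private theorem coe_primesEquiv_eq_of_natCast_mem_aux' {p : ℕ} [hp : Fact p.Prime] {v : HeightOneSpectrum (𝓞 ℚ)}
    (hpv : (p : 𝓞 ℚ) ∈ v.asIdeal) : ((primesEquiv v : Nat.Primes) : ℕ) = p := by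
  have h : natGenerator v ∣ p := by
    rw [natGenerator_dvd_iff, ← map_natCast (Rat.IsIntegralClosure.intEquiv (𝓞 ℚ)) p]
    exact Ideal.mem_map_of_mem _ hpv
  exact (Nat.prime_dvd_prime_iff_eq (prime_natGenerator v) hp.out).mp h

/-- **The model data at `v ∋ p`**: an isomorphism of algebraic closures `Φ : ℚ̄_p ≃ ℚ̄_v` over `ℚ` lying over a field isomorphism
`φ : ℚ_[p] ≃ ℚ_v` (Mathlib's `adicCompletion.padicEquiv`, `IsAlgClosure.equivOfEquiv`), together with an embedding `ι : ℚ̄ → ℚ̄_p` with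
`closureEmb ℚ_v = Φ ∘ ι` (`ι := Φ⁻¹ ∘ closureEmb`). [cite: MilneFT2022, Ch. 6] [cite: SerreGaloisCohomology1997, II.§1.1] -/
theorem exists_model_padic_adicCompletion {p : ℕ} [Fact p.Prime] {v : HeightOneSpectrum (𝓞 ℚ)} (hv : (p : 𝓞 ℚ) ∈ v.asIdeal) :
    ∃ (Φ : AlgebraicClosure ℚ_[p] ≃ₐ[ℚ] AlgebraicClosure (v.adicCompletion ℚ)) (φ : ℚ_[p] ≃+* v.adicCompletion ℚ),
      (∀ y : ℚ_[p], Φ (algebraMap ℚ_[p] (AlgebraicClosure ℚ_[p]) y) =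
        algebraMap (v.adicCompletion ℚ) (AlgebraicClosure (v.adicCompletion ℚ)) (φ y)) ∧
      ∃ ι : AlgebraicClosure ℚ →ₐ[ℚ] AlgebraicClosure ℚ_[p], ∀ z, closureEmb (K := ℚ) (v.adicCompletion ℚ) z = Φ (ι z) := by
  obtain rfl : ((primesEquiv v : Nat.Primes) : ℕ) = p := coe_primesEquiv_eq_of_natCast_mem_aux' hv
  let e : ℚ_[(primesEquiv v : ℕ)] ≃ₐ[ℚ] v.adicCompletion ℚ := (adicCompletion.padicEquiv v).toAlgEquiv.symm
  let Φr : AlgebraicClosure ℚ_[(primesEquiv v : ℕ)] ≃+* AlgebraicClosure (v.adicCompletion ℚ) :=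
    IsAlgClosure.equivOfEquiv (AlgebraicClosure ℚ_[(primesEquiv v : ℕ)]) (AlgebraicClosure (v.adicCompletion ℚ)) e.toRingEquiv
  have hf : ∀ y, Φr (algebraMap ℚ_[(primesEquiv v : ℕ)] (AlgebraicClosure ℚ_[(primesEquiv v : ℕ)]) y) =
      algebraMap (v.adicCompletion ℚ) (AlgebraicClosure (v.adicCompletion ℚ)) (e.toRingEquiv y) :=
    fun y ↦ IsAlgClosure.equivOfEquiv_algebraMap _ _ e.toRingEquiv y
  have hK : ∀ c : ℚ, Φr (algebraMap ℚ (AlgebraicClosure ℚ_[(primesEquiv v : ℕ)]) c) =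
      algebraMap ℚ (AlgebraicClosure (v.adicCompletion ℚ)) c := by
    intro c
    rw [eq_ratCast (algebraMap ℚ (AlgebraicClosure ℚ_[(primesEquiv v : ℕ)])), eq_ratCast (algebraMap ℚ _), map_ratCast]
  let Φ : AlgebraicClosure ℚ_[(primesEquiv v : ℕ)] ≃ₐ[ℚ] AlgebraicClosure (v.adicCompletion ℚ) := { Φr with commutes' := hK }
  refine ⟨Φ, e.toRingEquiv, fun y ↦ hf y,
    ((Φ.symm : AlgebraicClosure (v.adicCompletion ℚ) ≃ₐ[ℚ] AlgebraicClosure ℚ_[(primesEquiv v : ℕ)]) :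
      AlgebraicClosure (v.adicCompletion ℚ) →ₐ[ℚ] AlgebraicClosure ℚ_[(primesEquiv v : ℕ)]).comp
      (closureEmb (K := ℚ) (v.adicCompletion ℚ)), fun z ↦ ?_⟩
  exact (Φ.apply_symm_apply _).symm

end Padic

end Literature.NumberTheory.EllipticCurves.Sprung2012.Honda.SignedEC

end Part2

/-!
## Part 3 — port of `Summits/BirchSwinnertonDyer/BirchSwinnertonDyer/Theorems/PrintX8VSInputHondaSystemPrimalTransport.lean` (2 declarations kept)

# Model transport of the PRIMAL Honda data (levels, the three relations, generation with a multiplier) from Mathlib's `ℚ_[p]`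
# (every embedding `ι`) to the completion `ℚ_v = v.adicCompletion ℚ` (the chosen embedding `closureEmb ℚ_v`)

(Port of the declarations listed in the Part header; the source module's docstring — cell bookkeeping of the BSD
printed-inputs programme — is abridged to its title here.)
-/

section Part3

open scoped _root_.Classical _root_.NumberField

open _root_.NumberField _root_.IsDedekindDomain _root_.WeierstrassCurve Literature.NumberTheory.EllipticCurves
  Literature.NumberTheory.GaloisRepresentations Literature.NumberTheory.EllipticCurves.Kobayashi2003

universe u

namespace Literature.NumberTheory.EllipticCurves.Sprung2012.Honda

namespace SprungHonda

open Literature.NumberTheory.EllipticCurves.Sprung2012.Honda.SignedEC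

section Generic

variable {K : Type u} [Field K] {E : Type u} [Field E] [Algebra K E] {E' : Type u} [Field E'] [Algebra K E']
  (Φ : AlgebraicClosure E ≃ₐ[K] AlgebraicClosure E') (φ : E ≃+* E')
  (hf : ∀ y : E, Φ (algebraMap E (AlgebraicClosure E) y) = algebraMap E' (AlgebraicClosure E') (φ y))
  (ι : AlgebraicClosure K →ₐ[K] AlgebraicClosure E) (ι' : AlgebraicClosure K →ₐ[K] AlgebraicClosure E')
  (hcompat : ∀ z : AlgebraicClosure K, ι' z = Φ (ι z))
  (W : WeierstrassCurve K) (T : localPoints W E →+ localPoints W E')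
  (hT : ∀ P : localPoints W E, T P =
    WeierstrassCurve.Affine.Point.map (W' := W) (Φ : AlgebraicClosure E →ₐ[K] AlgebraicClosure E')
      (show (W.baseChange (AlgebraicClosure E)).toAffine.Point from P))
  {p : ℕ} [Fact p.Prime] (κ : ZpExtension K p)

include hf hcompat hT in
/-- **The primal Honda data moves along an isomorphism of models**: levels, the three trace relations of `IsHondaSystem`, and the
generation clauses with a multiplier `N`, for `(cneg, c)` at (`E`, `ι`), yield the same for `(T cneg, T ∘ c)` at (`E'`, `ι'`).
[cite: SerreGaloisCohomology1997, II.§1.1] [cite: Kobayashi2003, Def. 1.1] -/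
theorem primalHonda_modelTransport (ap : ℤ)
    (h : ∃ (cneg : localPoints W E) (c : ℕ → localPoints W E) (N : ℕ), N.Coprime p ∧
      cneg ∈ localLayerPointsOfEmb κ ι W 0 ∧ (∀ n, c n ∈ localLayerPointsOfEmb κ ι W n) ∧
      c 0 = (ap - 2) • cneg ∧
      localTraceOfEmb κ ι W 0 1 (c 1) = ap • c 0 - ((p : ℤ) - 1) • cneg ∧
      (∀ n : ℕ, 1 ≤ n → localTraceOfEmb κ ι W n (n + 1) (c (n + 1)) = ap • c n - c (n - 1)) ∧
      (∀ m : ℕ, 1 ≤ m → ∀ P ∈ localLayerPointsOfEmb κ ι W m,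
        ∃ B ∈ AddSubgroup.closure (Set.range fun σ : Field.absoluteGaloisGroup E ↦ σ • c m),
          ∃ P' ∈ localLayerPointsOfEmb κ ι W (m - 1), ∃ R ∈ localLayerPointsOfEmb κ ι W m, N • P = B + P' + p • R) ∧
      (∀ P ∈ localLayerPointsOfEmb κ ι W 0, ∃ u : ℤ, ∃ R ∈ localLayerPointsOfEmb κ ι W 0, N • P = u • cneg + p • R)) :
    ∃ (cneg : localPoints W E') (c : ℕ → localPoints W E') (N : ℕ), N.Coprime p ∧
      cneg ∈ localLayerPointsOfEmb κ ι' W 0 ∧ (∀ n, c n ∈ localLayerPointsOfEmb κ ι' W n) ∧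
      c 0 = (ap - 2) • cneg ∧
      localTraceOfEmb κ ι' W 0 1 (c 1) = ap • c 0 - ((p : ℤ) - 1) • cneg ∧
      (∀ n : ℕ, 1 ≤ n → localTraceOfEmb κ ι' W n (n + 1) (c (n + 1)) = ap • c n - c (n - 1)) ∧
      (∀ m : ℕ, 1 ≤ m → ∀ P ∈ localLayerPointsOfEmb κ ι' W m,
        ∃ B ∈ AddSubgroup.closure (Set.range fun σ : Field.absoluteGaloisGroup E' ↦ σ • c m),
          ∃ P' ∈ localLayerPointsOfEmb κ ι' W (m - 1), ∃ R ∈ localLayerPointsOfEmb κ ι' W m, N • P = B + P' + p • R) ∧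
      (∀ P ∈ localLayerPointsOfEmb κ ι' W 0, ∃ u : ℤ, ∃ R ∈ localLayerPointsOfEmb κ ι' W 0, N • P = u • cneg + p • R) := by
  have hmem := modelMap_mem_localLayerPointsOfEmb_iff Φ φ hf ι ι' hcompat W T hT κ
  have htr := fun m k {P : localPoints W E} (hP : P ∈ localLayerPointsOfEmb κ ι W k) ↦
    modelMap_localTraceOfEmb Φ φ hf ι ι' hcompat W T hT κ m k hP
  obtain ⟨cneg, c, N, hN, hcneg, hc, hR0, hR1, hRn, hgen, hgen0⟩ := h
  refine ⟨T cneg, fun n ↦ T (c n), N, hN, (hmem 0 _).mpr hcneg, fun n ↦ (hmem n _).mpr (hc n), ?_, ?_, ?_, ?_, ?_⟩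
  · dsimp only
    rw [hR0, map_zsmul]
  · dsimp only
    rw [← htr 0 1 (hc 1), hR1, map_sub, map_zsmul, map_zsmul]
  · intro n hn
    dsimp only
    rw [← htr n (n + 1) (hc (n + 1)), hRn n hn, map_sub, map_zsmul]
  · intro m hm P' hP'
    dsimp only
    obtain ⟨P, rfl⟩ := modelMap_surjective Φ W T hT P'
    obtain ⟨B, hB, P₁, hP₁, R, hR, hPe⟩ := hgen m hm P ((hmem m P).mp hP')
    refine ⟨T B, ?_, T P₁, (hmem _ _).mpr hP₁, T R, (hmem _ _).mpr hR, by rw [← map_nsmul, hPe, map_add, map_add, map_nsmul]⟩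
    rw [← map_modelMap_closure_orbit Φ φ hf W T hT]
    exact AddSubgroup.mem_map_of_mem T hB
  · intro P' hP'
    obtain ⟨P, rfl⟩ := modelMap_surjective Φ W T hT P'
    obtain ⟨u, R, hR, hPe⟩ := hgen0 P ((hmem 0 P).mp hP')
    exact ⟨u, T R, (hmem _ _).mpr hR, by rw [← map_nsmul, hPe, map_add, map_zsmul, map_nsmul]⟩

end Generic

/-! ## `K = ℚ`: from Mathlib's `ℚ_[p]` (every embedding) to `ℚ_v` (the chosen embedding) -/

section Padic

/-- **Primal Honda data over (`ℚ_[p]`, every `ι`) ⟹ over (`ℚ_v`, `closureEmb`)** at the place `v ∋ p`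
(tree `SignedEC.exists_model_padic_adicCompletion`: `Φ : ℚ̄_p ≃ ℚ̄_v` over `ℚ_[p] ≃ ℚ_v`, `closureEmb = Φ ∘ ι`).
[cite: SerreGaloisCohomology1997, II.§1.1] [cite: Kobayashi2003, Def. 1.1] [cite: MilneFT2022, Ch. 6] -/
theorem primalHonda_adicCompletion_of_padic {p : ℕ} [Fact p.Prime] (W : WeierstrassCurve ℚ) (κ : ZpExtension ℚ p) (ap : ℤ)
    (v : HeightOneSpectrum (𝓞 ℚ)) (hv : (p : 𝓞 ℚ) ∈ v.asIdeal)
    (h : ∀ ι : AlgebraicClosure ℚ →ₐ[ℚ] AlgebraicClosure ℚ_[p],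
      ∃ (cneg : localPoints W ℚ_[p]) (c : ℕ → localPoints W ℚ_[p]) (N : ℕ), N.Coprime p ∧
      cneg ∈ localLayerPointsOfEmb κ ι W 0 ∧ (∀ n, c n ∈ localLayerPointsOfEmb κ ι W n) ∧
      c 0 = (ap - 2) • cneg ∧
      localTraceOfEmb κ ι W 0 1 (c 1) = ap • c 0 - ((p : ℤ) - 1) • cneg ∧
      (∀ n : ℕ, 1 ≤ n → localTraceOfEmb κ ι W n (n + 1) (c (n + 1)) = ap • c n - c (n - 1)) ∧
      (∀ m : ℕ, 1 ≤ m → ∀ P ∈ localLayerPointsOfEmb κ ι W m,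
        ∃ B ∈ AddSubgroup.closure (Set.range fun σ : Field.absoluteGaloisGroup ℚ_[p] ↦ σ • c m),
          ∃ P' ∈ localLayerPointsOfEmb κ ι W (m - 1), ∃ R ∈ localLayerPointsOfEmb κ ι W m, N • P = B + P' + p • R) ∧
      (∀ P ∈ localLayerPointsOfEmb κ ι W 0, ∃ u : ℤ, ∃ R ∈ localLayerPointsOfEmb κ ι W 0, N • P = u • cneg + p • R)) :
    ∃ (cneg : localPoints W (v.adicCompletion ℚ)) (c : ℕ → localPoints W (v.adicCompletion ℚ)) (N : ℕ), N.Coprime p ∧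
      cneg ∈ localLayerPointsOfEmb κ (closureEmb (K := ℚ) (v.adicCompletion ℚ)) W 0 ∧
      (∀ n, c n ∈ localLayerPointsOfEmb κ (closureEmb (K := ℚ) (v.adicCompletion ℚ)) W n) ∧
      c 0 = (ap - 2) • cneg ∧
      localTraceOfEmb κ (closureEmb (K := ℚ) (v.adicCompletion ℚ)) W 0 1 (c 1) = ap • c 0 - ((p : ℤ) - 1) • cneg ∧
      (∀ n : ℕ, 1 ≤ n → localTraceOfEmb κ (closureEmb (K := ℚ) (v.adicCompletion ℚ)) W n (n + 1) (c (n + 1)) =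
        ap • c n - c (n - 1)) ∧
      (∀ m : ℕ, 1 ≤ m → ∀ P ∈ localLayerPointsOfEmb κ (closureEmb (K := ℚ) (v.adicCompletion ℚ)) W m,
        ∃ B ∈ AddSubgroup.closure (Set.range fun σ : Field.absoluteGaloisGroup (v.adicCompletion ℚ) ↦ σ • c m),
          ∃ P' ∈ localLayerPointsOfEmb κ (closureEmb (K := ℚ) (v.adicCompletion ℚ)) W (m - 1),
          ∃ R ∈ localLayerPointsOfEmb κ (closureEmb (K := ℚ) (v.adicCompletion ℚ)) W m, N • P = B + P' + p • R) ∧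
      (∀ P ∈ localLayerPointsOfEmb κ (closureEmb (K := ℚ) (v.adicCompletion ℚ)) W 0,
        ∃ u : ℤ, ∃ R ∈ localLayerPointsOfEmb κ (closureEmb (K := ℚ) (v.adicCompletion ℚ)) W 0, N • P = u • cneg + p • R) := by
  obtain ⟨Φ, φ, hf, ι, hcompat⟩ := exists_model_padic_adicCompletion (p := p) hv
  exact primalHonda_modelTransport Φ φ hf ι (closureEmb (K := ℚ) (v.adicCompletion ℚ)) hcompat W
    (show localPoints W ℚ_[p] →+ localPoints W (v.adicCompletion ℚ) from
      WeierstrassCurve.Affine.Point.map (W' := W) (Φ : AlgebraicClosure ℚ_[p] →ₐ[ℚ] AlgebraicClosure (v.adicCompletion ℚ)))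
    (fun _ ↦ rfl) κ ap (h ι)

end Padic

end SprungHonda

end Literature.NumberTheory.EllipticCurves.Sprung2012.Honda

end Part3

/-!
## Part 4 — port of `Summits/BirchSwinnertonDyer/BirchSwinnertonDyer/Theorems/SignedLowerHalvesSprungLowerHalfAtThreeChromaticCongruence.lean` (4 declarations kept)

# Sprung pairs attached to mod-`(p, ω_n)`-congruent Mazur–Tate data are congruent mod `pΛ` — the Λ-lemma
# behind the analytic ♯/♭ ↔ ± transfer

(Port of the declarations listed in the Part header; the source module's docstring — cell bookkeeping of the BSD
printed-inputs programme — is abridged to its title here.)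
-/

section Part4

open scoped _root_.MatrixGroups _root_.ModularForm

open _root_.CongruenceSubgroup _root_.Polynomial Literature.NumberTheory.EllipticCurves
  Literature.NumberTheory.EllipticCurves.ModularForms
  Literature.NumberTheory.EllipticCurves.Sprung2017
  Literature.NumberTheory.EllipticCurves.GreenbergVatsal2000
  Literature.NumberTheory.EllipticCurves.Rank1Residual

namespace Literature.NumberTheory.EllipticCurves.Sprung2012.Honda

namespace ChromaticCongruence

variable {p : ℕ} [hp : Fact p.Prime]

/-! ### §1 Reduction modulo `p` of `Λ = ℤ_p⟦T⟧` -/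

/-- `Λ → 𝔽_p⟦T⟧` kills exactly the multiples of `p`: `ḡ = 0 ↔ p ∣ g` in `Λ`. [cite: Sprung2017, §4 Cor. 4.4] -/
theorem map_toZMod_eq_zero_iff (g : IwasawaAlgebra p) :
    PowerSeries.map (PadicInt.toZMod (p := p)) g = 0 ↔ PowerSeries.C (p : ℤ_[p]) ∣ g := by
  rw [Literature.NumberTheory.EllipticCurves.PowerSeries.C_dvd_iff_forall_dvd_coeff]
  constructor
  · intro h n
    have hn := congrArg (PowerSeries.coeff n) h
    rw [PowerSeries.coeff_map, map_zero] at hn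
    have hmem : PowerSeries.coeff n g ∈ RingHom.ker (PadicInt.toZMod (p := p)) := hn
    rwa [PadicInt.ker_toZMod, PadicInt.maximalIdeal_eq_span_p, Ideal.mem_span_singleton] at hmem
  · intro h
    ext n
    rw [PowerSeries.coeff_map, map_zero]
    have hmem : PowerSeries.coeff n g ∈ RingHom.ker (PadicInt.toZMod (p := p)) := by
      rw [PadicInt.ker_toZMod, PadicInt.maximalIdeal_eq_span_p, Ideal.mem_span_singleton]
      exact h n
    exact hmem

/-- `p ↦ 0` under `Λ → 𝔽_p⟦T⟧`. [cite: Sprung2017, §4 Cor. 4.4] -/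
theorem map_toZMod_C_natCast :
    PowerSeries.map (PadicInt.toZMod (p := p)) (PowerSeries.C (p : ℤ_[p])) = 0 := by
  rw [PowerSeries.map_C, map_natCast, ZMod.natCast_self, map_zero]

/-- Reduction of a polynomial with integer coefficients viewed in `Λ`: coefficientwise `ℤ → 𝔽_p`.
[cite: Sprung2017, §4 Cor. 4.4] -/
theorem map_toZMod_toIwasawa (q : ℤ[X]) :
    PowerSeries.map (PadicInt.toZMod (p := p)) (toIwasawa p q) =
      ((q.map (Int.castRingHom (ZMod p)) : (ZMod p)[X]) : PowerSeries (ZMod p)) := by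
  ext n
  show PadicInt.toZMod (PowerSeries.coeff n
      (((q.map (Int.castRingHom ℤ_[p])) : ℤ_[p][X]) : PowerSeries ℤ_[p])) = _
  rw [Polynomial.coeff_coe, Polynomial.coeff_coe, Polynomial.coeff_map, Polynomial.coeff_map,
    eq_intCast, eq_intCast, map_intCast]

/-- `ω_n = (1+T)^{pⁿ} − 1 ↦ T^{pⁿ}` in `𝔽_p⟦T⟧` (Frobenius). [cite: Sprung2017, §4 Cor. 4.4] -/
theorem map_toZMod_cyclotomicOmega (n : ℕ) :
    PowerSeries.map (PadicInt.toZMod (p := p)) (toIwasawa p (cyclotomicOmega p n)) =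
      PowerSeries.X ^ p ^ n := by
  rw [map_toZMod_toIwasawa, cyclotomicOmega, Polynomial.map_sub, Polynomial.map_pow,
    Polynomial.map_add, Polynomial.map_X, Polynomial.map_one,
    add_pow_char_pow, one_pow, add_sub_cancel_right, Polynomial.coe_pow, Polynomial.coe_X]

end ChromaticCongruence

end Literature.NumberTheory.EllipticCurves.Sprung2012.Honda

end Part4

/-!
## Part 5 — port of `Summits/BirchSwinnertonDyer/BirchSwinnertonDyer/Theorems/PrintX8VSInputHondaSystemOmegaDivisibility.lean` (5 declarations kept)

# Divisibility by `ω_n = (1+T)^{pⁿ} − 1` in `Λ = ℤ_p⟦T⟧` read on the basis `(1+T)ʲ`, `j < pⁿ`, of `Λ/ω_n`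
#

(Port of the declarations listed in the Part header; the source module's docstring — cell bookkeeping of the BSD
printed-inputs programme — is abridged to its title here.)
-/

section Part5

open scoped _root_.Classical
open _root_.Polynomial _root_.Finset

namespace Literature.NumberTheory.EllipticCurves.Sprung2012.Honda

namespace SprungHonda

open Literature.NumberTheory.EllipticCurves Literature.NumberTheory.EllipticCurves.Sprung2017
  Literature.NumberTheory.EllipticCurves.Sprung2012

variable {p : ℕ} [hp : Fact p.Prime]

/-! ## §1 `Λ/ω_n` has no `p`-torsion -/

/-- **`Λ/ω_n` has no `p`-torsion**: `ω_n ∣ p·x ⇒ ω_n ∣ x` in `Λ = ℤ_p⟦T⟧` (`ω_n ≡ T^{pⁿ} (mod p)` and `𝔽_p⟦T⟧` is a domain, so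
`p·x = ω_n q` forces `p ∣ q`). [cite: Washington1997, Prop. 7.2] -/
theorem omega_dvd_of_omega_dvd_C_mul {n : ℕ} {x : PowerSeries ℤ_[p]}
    (h : toIwasawa p (cyclotomicOmega p n) ∣ PowerSeries.C (p : ℤ_[p]) * x) : toIwasawa p (cyclotomicOmega p n) ∣ x := by
  obtain ⟨q, hq⟩ := h
  -- reduce modulo `p`: `0 = T^{pⁿ} · q̄`, so `q̄ = 0`
  have hred := congrArg (PowerSeries.map (PadicInt.toZMod (p := p))) hq
  rw [map_mul, map_mul, ChromaticCongruence.map_toZMod_C_natCast, zero_mul, ChromaticCongruence.map_toZMod_cyclotomicOmega] at hred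
  have hq0 : PowerSeries.map (PadicInt.toZMod (p := p)) q = 0 :=
    (mul_eq_zero.mp hred.symm).resolve_left (pow_ne_zero _ PowerSeries.X_ne_zero)
  obtain ⟨q', rfl⟩ := (ChromaticCongruence.map_toZMod_eq_zero_iff q).mp hq0
  refine ⟨q', ?_⟩
  have hp0 : (PowerSeries.C (p : ℤ_[p])) ≠ 0 := by
    intro h0
    have h1 := congrArg PowerSeries.constantCoeff h0
    rw [PowerSeries.constantCoeff_C, map_zero] at h1
    exact (Nat.cast_ne_zero.mpr hp.out.ne_zero) h1
  rw [mul_left_comm] at hq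
  exact mul_left_cancel₀ hp0 hq

/-! ## §2 The basis `(1+T)ʲ`, `j < pⁿ`, of `Λ/ω_n` -/

/-- The combination `∑_{j<N} e_j (X+1)ʲ ∈ R[X]` is the Taylor shift of `∑_{j<N} e_j Xʲ`, so it vanishes only if every `e_j`
does. [cite: Washington1997, Prop. 7.2] -/
theorem forall_eq_zero_of_sum_C_mul_X_add_one_pow_eq_zero {R : Type*} [CommRing R] {N : ℕ} {e : ℕ → R}
    (h : ∑ j ∈ range N, C (e j) * (X + 1 : R[X]) ^ j = 0) : ∀ j < N, e j = 0 := by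
  set g : R[X] := ∑ j ∈ range N, C (e j) * X ^ j with hg
  have hcomp : g.comp (X + 1) = ∑ j ∈ range N, C (e j) * (X + 1 : R[X]) ^ j := by
    rw [hg, Polynomial.sum_comp]
    simp only [Polynomial.mul_comp, Polynomial.C_comp, Polynomial.pow_comp, Polynomial.X_comp]
  have hg0 : g = 0 := by
    have h1 : (g.comp (X + 1)).comp (X - 1) = 0 := by rw [hcomp, h, Polynomial.zero_comp]
    rwa [Polynomial.comp_assoc, Polynomial.add_comp, Polynomial.X_comp, Polynomial.one_comp, sub_add_cancel,
      Polynomial.comp_X] at h1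
  intro j hj
  have := congrArg (fun q : R[X] ↦ q.coeff j) hg0
  simp only [hg, Polynomial.finsetSum_coeff, Polynomial.coeff_C_mul_X_pow, Polynomial.coeff_zero] at this
  rw [Finset.sum_eq_single j (fun k _ hk ↦ if_neg (Ne.symm hk)) (fun hj' ↦ absurd (mem_range.mpr hj) hj')] at this
  simpa using this

/-- The combination `∑_{j<pⁿ} e_j (X+1)ʲ` has degree `< pⁿ`. [cite: Washington1997, Prop. 7.2] -/
theorem natDegree_sum_C_mul_X_add_one_pow_lt {R : Type*} [CommRing R] [Nontrivial R] (n : ℕ) (e : ℕ → R) :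
    (∑ j ∈ range (p ^ n), C (e j) * (X + 1 : R[X]) ^ j).natDegree < p ^ n := by
  have hp1 : 0 < p ^ n := pow_pos hp.out.pos n
  have hle : (∑ j ∈ range (p ^ n), C (e j) * (X + 1 : R[X]) ^ j).natDegree ≤ p ^ n - 1 := by
    refine Polynomial.natDegree_sum_le_of_forall_le (range (p ^ n)) (fun j ↦ C (e j) * (X + 1 : R[X]) ^ j) fun j hj ↦ ?_
    have hj' := mem_range.mp hj
    have hX1 : (X + 1 : R[X]).natDegree = 1 := by
      rw [← map_one (Polynomial.C (R := R))]; exact Polynomial.natDegree_X_add_C 1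
    calc (C (e j) * (X + 1 : R[X]) ^ j).natDegree ≤ (C (e j)).natDegree + ((X + 1 : R[X]) ^ j).natDegree :=
          Polynomial.natDegree_mul_le
      _ ≤ 0 + j * (X + 1 : R[X]).natDegree := by
          gcongr
          · exact (Polynomial.natDegree_C _).le
          · exact Polynomial.natDegree_pow_le
      _ ≤ p ^ n - 1 := by rw [hX1, zero_add, mul_one]; omega
  omega

/-- **`ω_n ∣ ∑_{j<pⁿ} e_j (1+T)ʲ` in `Λ` forces `e_j = 0` for all `j < pⁿ`**: by Weierstrass division (tree
`Sprung2012.omega_dvd_of_coe_dvd`) the monic `ω_n` of degree `pⁿ` divides the polynomial `∑ e_j (X+1)ʲ` of degree `< pⁿ` in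
`ℤ_p[X]`, which is therefore `0`. (`{(1+T)ʲ}_{j<pⁿ}` is a `ℤ_p`-basis of `Λ_n = Λ/ω_n ≅ ℤ_p[Γ/Γ^{pⁿ}]`.)
[cite: Washington1997, Prop. 7.2] [cite: Sprung2012, Def. 3.1 (Λ_n, γ ↦ 1+T)] -/
theorem forall_eq_zero_of_omega_dvd_sum {n : ℕ} {e : ℕ → ℤ_[p]}
    (h : toIwasawa p (cyclotomicOmega p n) ∣ ∑ j ∈ range (p ^ n), PowerSeries.C (e j) * (1 + PowerSeries.X) ^ j) :
    ∀ j < p ^ n, e j = 0 := by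
  set f : ℤ_[p][X] := ∑ j ∈ range (p ^ n), C (e j) * (X + 1 : ℤ_[p][X]) ^ j with hf
  have hcoe : (f : PowerSeries ℤ_[p]) = ∑ j ∈ range (p ^ n), PowerSeries.C (e j) * (1 + PowerSeries.X) ^ j := by
    rw [hf, ← Polynomial.coeToPowerSeries.ringHom_apply, map_sum]
    refine sum_congr rfl fun j _ ↦ ?_
    rw [map_mul, map_pow, map_add, map_one, Polynomial.coeToPowerSeries.ringHom_apply, Polynomial.coeToPowerSeries.ringHom_apply,
      Polynomial.coe_C, Polynomial.coe_X, add_comm]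
  rw [← hcoe, toIwasawa_cyclotomicOmega_eq_coe] at h
  have hdvd := omega_dvd_of_coe_dvd h
  have hX1 : (X + 1 : ℤ_[p][X]) = X + C 1 := by rw [map_one]
  have hdeg : ((X + 1 : ℤ_[p][X]) ^ p ^ n - 1).natDegree = p ^ n := by
    have hpow : ((X + 1 : ℤ_[p][X]) ^ p ^ n).natDegree = p ^ n := by
      rw [hX1, Polynomial.natDegree_pow, Polynomial.natDegree_X_add_C, mul_one]
    rw [Polynomial.natDegree_sub_eq_left_of_natDegree_lt] <;> rw [hpow]
    rw [Polynomial.natDegree_one]; exact pow_pos hp.out.pos n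
  have hf0 : f = 0 :=
    Polynomial.eq_zero_of_dvd_of_natDegree_lt hdvd (by rw [hdeg]; exact natDegree_sum_C_mul_X_add_one_pow_lt n e)
  exact forall_eq_zero_of_sum_C_mul_X_add_one_pow_eq_zero hf0

/-- **Mod-`p` reading**: `ω_n ∣ p·y − ∑_{j<pⁿ} e_j (1+T)ʲ` in `Λ` forces `p ∣ e_j` for all `j < pⁿ` (reduce modulo `p`:
`T^{pⁿ}` divides the polynomial `∑ ē_j (X+1)ʲ` of degree `< pⁿ` in `𝔽_p[X]`, which is therefore `0`).
[cite: Washington1997, Prop. 7.2] [cite: Sprung2012, Def. 3.1 (Λ_n, γ ↦ 1+T)] -/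
theorem forall_dvd_of_omega_dvd_C_mul_sub_sum {n : ℕ} {y : PowerSeries ℤ_[p]} {e : ℕ → ℤ_[p]}
    (h : toIwasawa p (cyclotomicOmega p n) ∣
      PowerSeries.C (p : ℤ_[p]) * y - ∑ j ∈ range (p ^ n), PowerSeries.C (e j) * (1 + PowerSeries.X) ^ j) :
    ∀ j < p ^ n, (p : ℤ_[p]) ∣ e j := by
  obtain ⟨q, hq⟩ := h
  set f : (ZMod p)[X] := ∑ j ∈ range (p ^ n), C (PadicInt.toZMod (e j)) * (X + 1 : (ZMod p)[X]) ^ j with hf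
  have hcoe : (f : PowerSeries (ZMod p)) =
      PowerSeries.map (PadicInt.toZMod (p := p)) (∑ j ∈ range (p ^ n), PowerSeries.C (e j) * (1 + PowerSeries.X) ^ j) := by
    rw [hf, ← Polynomial.coeToPowerSeries.ringHom_apply, map_sum, map_sum]
    refine sum_congr rfl fun j _ ↦ ?_
    rw [map_mul, map_pow, map_add, map_one, Polynomial.coeToPowerSeries.ringHom_apply, Polynomial.coeToPowerSeries.ringHom_apply,
      Polynomial.coe_C, Polynomial.coe_X, map_mul, map_pow, PowerSeries.map_C, map_add, map_one, PowerSeries.map_X, add_comm]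
  -- reduce modulo `p`: `T^{pⁿ} ∣ f` in `𝔽_p⟦T⟧`
  have hred := congrArg (PowerSeries.map (PadicInt.toZMod (p := p))) hq
  rw [map_sub, map_mul, ChromaticCongruence.map_toZMod_C_natCast, zero_mul, zero_sub, map_mul,
    ChromaticCongruence.map_toZMod_cyclotomicOmega, ← hcoe, neg_eq_iff_eq_neg, ← mul_neg] at hred
  have hXdvd : (PowerSeries.X : PowerSeries (ZMod p)) ^ p ^ n ∣ (f : PowerSeries (ZMod p)) := ⟨_, hred⟩
  -- so `f = 0` (degree `< pⁿ`)
  have hf0 : f = 0 := by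
    ext d
    rw [Polynomial.coeff_zero]
    by_cases hd : d < p ^ n
    · have := (PowerSeries.X_pow_dvd_iff.mp hXdvd) d hd
      rwa [Polynomial.coeff_coe] at this
    · exact Polynomial.coeff_eq_zero_of_natDegree_lt (lt_of_lt_of_le (natDegree_sum_C_mul_X_add_one_pow_lt n _) (by omega))
  intro j hj
  have hej : PadicInt.toZMod (e j) = 0 := forall_eq_zero_of_sum_C_mul_X_add_one_pow_eq_zero hf0 j hj
  have hmem : e j ∈ Ideal.span {(p : ℤ_[p])} := by
    rw [← PadicInt.maximalIdeal_eq_span_p, ← PadicInt.ker_toZMod, RingHom.mem_ker]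
    exact hej
  exact Ideal.mem_span_singleton.mp hmem

end SprungHonda

end Literature.NumberTheory.EllipticCurves.Sprung2012.Honda

end Part5

/-!
## Part 6 — port of `Summits/BirchSwinnertonDyer/BirchSwinnertonDyer/Theorems/PrintX8VSInputHondaSystemDualCore.lean` (12 declarations kept)

# From generation to the dual: the `p`-adic divisibility engine behind the DUAL generation clauses of
# `Sprung2012.IsHondaSystem`

(Port of the declarations listed in the Part header; the source module's docstring — cell bookkeeping of the BSD
printed-inputs programme — is abridged to its title here.)
-/

section Part6

open scoped _root_.Classical
open _root_.Finset

universe u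

namespace Literature.NumberTheory.EllipticCurves.Sprung2012.Honda

namespace SprungHonda

open Literature.NumberTheory.EllipticCurves Literature.NumberTheory.GaloisRepresentations
  Literature.NumberTheory.EllipticCurves.ZpExtension Literature.NumberTheory.EllipticCurves.Kobayashi2003
  Literature.NumberTheory.EllipticCurves.Sprung2012

variable {K : Type u} [Field K] {p : ℕ} [hp : Fact p.Prime] (κ : ZpExtension K p)
variable {E : Type u} [Field E] [Algebra K E] (ι : AlgebraicClosure K →ₐ[K] AlgebraicClosure E) (W : WeierstrassCurve K)

/-! ## §1 `ℤ_p`-bookkeeping -/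

omit hp in
/-- An element of `ℤ_p` divisible by every power of `p` is `0`. [cite: Sprung2012, §2 p. 1486 (Γ/Γ_n, γ)] -/
theorem padicInt_eq_zero_of_forall_pow_dvd [Fact p.Prime] {x : ℤ_[p]} (h : ∀ k : ℕ, (p : ℤ_[p]) ^ k ∣ x) : x = 0 := by
  by_contra hx
  have hpos : 0 < ‖x‖ := norm_pos_iff.mpr hx
  have hp1 : ((p : ℝ))⁻¹ < 1 := inv_lt_one_of_one_lt₀ (by exact_mod_cast (Fact.out : p.Prime).one_lt)
  obtain ⟨k, hk⟩ := exists_pow_lt_of_lt_one hpos hp1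
  have hle : ‖x‖ ≤ (p : ℝ) ^ (-(k : ℤ)) := by
    rw [PadicInt.norm_le_pow_iff_mem_span_pow]
    exact Ideal.mem_span_singleton.mpr (h k)
  rw [zpow_neg, zpow_natCast, ← inv_pow] at hle
  exact absurd (lt_of_le_of_lt hle hk) (lt_irrefl _)

omit hp in
/-- A functional into `ℤ_p` all of whose values lie in `pℤ_p` is `p` times a functional. [cite: Sprung2012, §2 p. 1486 (Γ/Γ_n, γ)] -/
theorem exists_eq_smul_of_forall_dvd [Fact p.Prime] {A : Type*} [AddCommGroup A] (z : A →+ ℤ_[p])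
    (h : ∀ a, (p : ℤ_[p]) ∣ z a) : ∃ y : A →+ ℤ_[p], z = (p : ℤ_[p]) • y := by
  choose f hf using h
  have hp0 : (p : ℤ_[p]) ≠ 0 := by exact_mod_cast (Fact.out : p.Prime).ne_zero
  refine ⟨{ toFun := f, map_zero' := ?_, map_add' := ?_ }, ?_⟩
  · apply mul_left_cancel₀ hp0
    rw [← hf, map_zero, mul_zero]
  · intro a b
    apply mul_left_cancel₀ hp0
    rw [← hf, map_add, hf a, hf b, mul_add]
  · ext a
    rw [AddMonoidHom.smul_apply, smul_eq_mul]
    exact hf a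

/-- An integer prime to `p` is a unit of `ℤ_p`. [cite: Sprung2012, §2 p. 1486 (Γ/Γ_n, γ)] -/
theorem isUnit_natCast_of_coprime {N : ℕ} (hN : N.Coprime p) : IsUnit ((N : ℕ) : ℤ_[p]) := by
  rw [PadicInt.isUnit_iff]
  by_contra hne
  have hlt : ‖((N : ℤ) : ℤ_[p])‖ < 1 := by
    rw [Int.cast_natCast]; exact lt_of_le_of_ne (PadicInt.norm_le_one _) hne
  rw [PadicInt.norm_int_lt_one_iff_dvd] at hlt
  have hpN : p ∣ N := by exact_mod_cast hlt
  have := Nat.eq_one_of_dvd_one (hN ▸ Nat.dvd_gcd hpN dvd_rfl)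
  exact hp.out.one_lt.ne' this

/-- `evalOn` is additive on members. [cite: Sprung2012, §2 p. 1486 (Γ/Γ_n, γ)] -/
theorem evalOn_add_mem (A : AddSubgroup (localPoints W E)) (z : A →+ ℤ_[p]) {P Q : localPoints W E} (hP : P ∈ A)
    (hQ : Q ∈ A) : evalOn W A z (P + Q) = evalOn W A z P + evalOn W A z Q := by
  rw [evalOn_of_mem W A z (add_mem hP hQ), evalOn_of_mem W A z hP, evalOn_of_mem W A z hQ, ← map_add]
  rfl

/-- `evalOn` commutes with `ℤ`-multiples on members. [cite: Sprung2012, §2 p. 1486 (Γ/Γ_n, γ)] -/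
theorem evalOn_zsmul_mem (A : AddSubgroup (localPoints W E)) (z : A →+ ℤ_[p]) {P : localPoints W E} (hP : P ∈ A)
    (k : ℤ) : evalOn W A z (k • P) = k * evalOn W A z P := by
  rw [evalOn_of_mem W A z (zsmul_mem hP k), evalOn_of_mem W A z hP, ← zsmul_eq_mul, ← map_zsmul]
  congr 1

/-- `evalOn` commutes with `ℕ`-multiples on members. [cite: Sprung2012, §2 p. 1486 (Γ/Γ_n, γ)] -/
theorem evalOn_nsmul_mem (A : AddSubgroup (localPoints W E)) (z : A →+ ℤ_[p]) {P : localPoints W E} (hP : P ∈ A)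
    (k : ℕ) : evalOn W A z (k • P) = k * evalOn W A z P := by
  rw [← natCast_zsmul, evalOn_zsmul_mem W A z hP, Int.cast_natCast]

/-- `evalOn` is additive over finite sums of members. [cite: Sprung2012, §2 p. 1486 (Γ/Γ_n, γ)] -/
theorem evalOn_sum_mem (A : AddSubgroup (localPoints W E)) (z : A →+ ℤ_[p]) {α : Type*} (s : Finset α)
    (P : α → localPoints W E) (hP : ∀ a ∈ s, P a ∈ A) :
    evalOn W A z (∑ a ∈ s, P a) = ∑ a ∈ s, evalOn W A z (P a) := by
  classical
  induction s using Finset.induction_on with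
  | empty =>
    rw [sum_empty, sum_empty, evalOn_of_mem W A z A.zero_mem]
    exact map_zero z
  | insert a s ha ih =>
    rw [sum_insert ha, sum_insert ha,
      evalOn_add_mem W A z (hP a (mem_insert_self a s)) (A.sum_mem fun b hb ↦ hP b (mem_insert_of_mem hb)),
      ih fun b hb ↦ hP b (mem_insert_of_mem hb)]

/-- Divisibility of `evalOn z` along the subgroup generated by a set of members. [cite: Sprung2012, §2 p. 1486 (Γ/Γ_n, γ)] -/
theorem dvd_evalOn_of_mem_closure (A : AddSubgroup (localPoints W E)) (z : A →+ ℤ_[p]) {d : ℤ_[p]}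
    {S : Set (localPoints W E)} (hS : S ⊆ A) (hdvd : ∀ Q ∈ S, d ∣ evalOn W A z Q) {B : localPoints W E}
    (hB : B ∈ AddSubgroup.closure S) : B ∈ A ∧ d ∣ evalOn W A z B := by
  induction hB using AddSubgroup.closure_induction with
  | mem x hx => exact ⟨hS hx, hdvd x hx⟩
  | zero => exact ⟨A.zero_mem, by rw [evalOn_of_mem W A z A.zero_mem]; exact ⟨0, by rw [mul_zero]; exact map_zero z⟩⟩
  | add x y _ _ hx hy =>
    exact ⟨add_mem hx.1 hy.1, by rw [evalOn_add_mem W A z hx.1 hy.1]; exact dvd_add hx.2 hy.2⟩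
  | neg x _ hx =>
    refine ⟨neg_mem hx.1, ?_⟩
    rw [← neg_one_zsmul, evalOn_zsmul_mem W A z hx.1]
    exact hx.2.mul_left _

/-! ## §2 `Γ`-orbits through the generator -/

/-- For a local lift `g` of the topological generator (`κ(res g) = 1`): `κ(res gʲ) = j`. [cite: Sprung2012, §2 p. 1486 (Γ/Γ_n, γ)] -/
theorem toAdd_kappa_res_pow {g : Field.absoluteGaloisGroup E} (hg : κ.IsTopGenerator (resGalOfEmb ι g)) (j : ℕ) :
    (κ (resGalOfEmb ι (g ^ j))).toAdd = (j : ℤ_[p]) := by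
  rw [map_pow]
  change (κ.toContinuousMonoidHom (resGalOfEmb ι g ^ j)).toAdd = _
  rw [map_pow, toAdd_pow]
  change j • (κ (resGalOfEmb ι g)).toAdd = _
  rw [hg, toAdd_ofAdd, nsmul_eq_mul, mul_one]

/-- **Every `Γ_E`-translate of a point of level `n` is a `gʲ`-translate, `j < pⁿ`** (the cosets of `Gal(Ē/K_n·E)` in `Γ_E` are
represented by the powers `gʲ`, `j < pⁿ`). [cite: Sprung2012, §2 p. 1486 (Γ/Γ_n, γ)] -/
theorem exists_smul_eq_pow_smul {g : Field.absoluteGaloisGroup E} (hg : κ.IsTopGenerator (resGalOfEmb ι g)) {n : ℕ}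
    {x : localPoints W E} (hx : x ∈ localLayerPointsOfEmb κ ι W n) (σ : Field.absoluteGaloisGroup E) :
    ∃ j < p ^ n, σ • x = g ^ j • x := by
  haveI : NeZero (p ^ n) := ⟨pow_ne_zero _ hp.out.ne_zero⟩
  set j := (PadicInt.toZModPow n (κ (resGalOfEmb ι σ)).toAdd).val with hj
  have hmem : σ⁻¹ * g ^ j ∈ localLayerSubgroupOfEmb κ ι n := by
    rw [mem_localLayerSubgroupOfEmb_iff, map_mul, map_inv]
    change (p : ℤ_[p]) ^ n ∣ (κ.toContinuousMonoidHom ((resGalOfEmb ι σ)⁻¹ * resGalOfEmb ι (g ^ j))).toAdd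
    rw [map_mul, map_inv, toAdd_mul, toAdd_inv]
    change (p : ℤ_[p]) ^ n ∣ -(κ (resGalOfEmb ι σ)).toAdd + (κ (resGalOfEmb ι (g ^ j))).toAdd
    rw [toAdd_kappa_res_pow κ ι hg, ← Ideal.mem_span_singleton, ← PadicInt.ker_toZModPow, RingHom.mem_ker, map_add,
      map_neg, map_natCast, hj, ZMod.natCast_zmod_val, neg_add_cancel]
  refine ⟨j, ZMod.val_lt _, ?_⟩
  have hfix := (mem_localLayerPointsOfEmb_iff κ ι W n x).mp hx _ hmem
  calc σ • x = σ • ((σ⁻¹ * g ^ j) • x) := by rw [hfix]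
    _ = g ^ j • x := by rw [← mul_smul, mul_inv_cancel_left]

/-! ## §3 The divisibility engine -/

/-- **The divisibility engine.** Given the primal generation data (`N` prime to `p`;
`N·P ∈ ℤ[Γ·c_m] + E(K_{m−1}·E) + p·E(K_m·E)` for `P ∈ E(K_m·E)`, `m ≥ 1`; `N·P ∈ ℤ·cneg + p·E(E)` for `P ∈ E(E)`), a functional
`z` on `E(K_n·E)` with `p^{K} ∣ z(σ•c_m)` for all `σ ∈ Γ_E`, `m ≤ n`, and `p^{K} ∣ z(cneg)` satisfies `p^{K} ∣ z(P)` for every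
`P ∈ E(K_n·E)` (induction on the exponent, then on the level). [cite: Sprung2012, Thm. 2.2 (p. 1487) (generation) and Cor. 2.10]
[cite: Kobayashi2003, Prop. 8.12] -/
theorem pow_dvd_evalOn_of_generation {N : ℕ} (hN : N.Coprime p) {cneg : localPoints W E} {c : ℕ → localPoints W E}
    (hcneg : cneg ∈ localLayerPointsOfEmb κ ι W 0) (hc : ∀ n, c n ∈ localLayerPointsOfEmb κ ι W n)
    (hGEN : ∀ m : ℕ, 1 ≤ m → ∀ P ∈ localLayerPointsOfEmb κ ι W m,
      ∃ B ∈ AddSubgroup.closure (Set.range fun σ : Field.absoluteGaloisGroup E ↦ σ • c m),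
        ∃ P' ∈ localLayerPointsOfEmb κ ι W (m - 1), ∃ R ∈ localLayerPointsOfEmb κ ι W m, N • P = B + P' + p • R)
    (hGEN0 : ∀ P ∈ localLayerPointsOfEmb κ ι W 0,
      ∃ u : ℤ, ∃ R ∈ localLayerPointsOfEmb κ ι W 0, N • P = u • cneg + p • R)
    (n K₀ : ℕ) (z : localLayerPointsOfEmb κ ι W n →+ ℤ_[p])
    (horb : ∀ m ≤ n, ∀ σ : Field.absoluteGaloisGroup E,
      (p : ℤ_[p]) ^ K₀ ∣ evalOn W (localLayerPointsOfEmb κ ι W n) z (σ • c m))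
    (hneg : (p : ℤ_[p]) ^ K₀ ∣ evalOn W (localLayerPointsOfEmb κ ι W n) z cneg) :
    ∀ P ∈ localLayerPointsOfEmb κ ι W n, (p : ℤ_[p]) ^ K₀ ∣ evalOn W (localLayerPointsOfEmb κ ι W n) z P := by
  have hmono := localLayerPointsOfEmb_mono κ ι W
  have hNu : IsUnit ((N : ℕ) : ℤ_[p]) := isUnit_natCast_of_coprime hN
  -- induction on the exponent `k ≤ K₀`, then on the level `m ≤ n`
  suffices hmain : ∀ k, k ≤ K₀ → ∀ m, m ≤ n → ∀ P ∈ localLayerPointsOfEmb κ ι W m, (p : ℤ_[p]) ^ k ∣ evalOn W (localLayerPointsOfEmb κ ι W n) z P from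
    fun P hP ↦ hmain K₀ le_rfl n le_rfl P hP
  intro k
  induction k with
  | zero => intro _ m _ P _; rw [pow_zero]; exact one_dvd _
  | succ k ih =>
    intro hk m
    induction m with
    | zero =>
      intro _ P hP
      obtain ⟨u, R, hR, hNP⟩ := hGEN0 P hP
      have hPn : P ∈ (localLayerPointsOfEmb κ ι W n) := hmono (Nat.zero_le n) hP
      have hRn : R ∈ (localLayerPointsOfEmb κ ι W n) := hmono (Nat.zero_le n) hR
      have hcn : cneg ∈ (localLayerPointsOfEmb κ ι W n) := hmono (Nat.zero_le n) hcneg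
      have key : (N : ℤ_[p]) * evalOn W (localLayerPointsOfEmb κ ι W n) z P = u * evalOn W (localLayerPointsOfEmb κ ι W n) z cneg + p * evalOn W (localLayerPointsOfEmb κ ι W n) z R := by
        rw [← evalOn_nsmul_mem W (localLayerPointsOfEmb κ ι W n) z hPn, hNP, evalOn_add_mem W (localLayerPointsOfEmb κ ι W n) z (zsmul_mem hcn u) (nsmul_mem hRn p),
          evalOn_zsmul_mem W (localLayerPointsOfEmb κ ι W n) z hcn, evalOn_nsmul_mem W (localLayerPointsOfEmb κ ι W n) z hRn]
      have hdvd : (p : ℤ_[p]) ^ (k + 1) ∣ (N : ℤ_[p]) * evalOn W (localLayerPointsOfEmb κ ι W n) z P := by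
        rw [key]
        refine dvd_add ((pow_dvd_pow _ hk).trans hneg |>.mul_left _) ?_
        rw [pow_succ']
        exact mul_dvd_mul_left _ (ih (Nat.le_of_succ_le hk) 0 (Nat.zero_le n) R hR)
      exact hNu.dvd_mul_left.mp hdvd
    | succ m ihm =>
      intro hm P hP
      obtain ⟨B, hB, P', hP', R, hR, hNP⟩ := hGEN (m + 1) (Nat.succ_pos m) P hP
      have hPn : P ∈ (localLayerPointsOfEmb κ ι W n) := hmono hm hP
      have hRn : R ∈ (localLayerPointsOfEmb κ ι W n) := hmono hm hR
      have hP'n : P' ∈ (localLayerPointsOfEmb κ ι W n) := hmono (by omega) hP'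
      have hBd : B ∈ (localLayerPointsOfEmb κ ι W n) ∧ (p : ℤ_[p]) ^ K₀ ∣ evalOn W (localLayerPointsOfEmb κ ι W n) z B := by
        refine dvd_evalOn_of_mem_closure W (localLayerPointsOfEmb κ ι W n) z ?_ ?_ hB
        · rintro _ ⟨σ, rfl⟩; exact hmono hm (smul_mem_localLayerPointsOfEmb κ ι W (m + 1) σ (hc (m + 1)))
        · rintro _ ⟨σ, rfl⟩; exact horb (m + 1) hm σ
      have key : (N : ℤ_[p]) * evalOn W (localLayerPointsOfEmb κ ι W n) z P = evalOn W (localLayerPointsOfEmb κ ι W n) z B + evalOn W (localLayerPointsOfEmb κ ι W n) z P' + p * evalOn W (localLayerPointsOfEmb κ ι W n) z R := by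
        rw [← evalOn_nsmul_mem W (localLayerPointsOfEmb κ ι W n) z hPn, hNP, evalOn_add_mem W (localLayerPointsOfEmb κ ι W n) z (add_mem hBd.1 hP'n) (nsmul_mem hRn p),
          evalOn_add_mem W (localLayerPointsOfEmb κ ι W n) z hBd.1 hP'n, evalOn_nsmul_mem W (localLayerPointsOfEmb κ ι W n) z hRn]
      have hdvd : (p : ℤ_[p]) ^ (k + 1) ∣ (N : ℤ_[p]) * evalOn W (localLayerPointsOfEmb κ ι W n) z P := by
        rw [key]
        refine dvd_add (dvd_add ((pow_dvd_pow _ hk).trans hBd.2) (ihm (by omega) P' (by simpa using hP'))) ?_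
        rw [pow_succ']
        exact mul_dvd_mul_left _ (ih (Nat.le_of_succ_le hk) (m + 1) hm R hR)
      exact hNu.dvd_mul_left.mp hdvd

/-! ## §4 Orbit propagation through the trace relations -/

/-- **Orbit propagation.** Let `c m ∈ E(K_m·E)`, `cneg ∈ E(E)` satisfy `Tr_{m+1/m} c_{m+1} = a_p c_m − c_{m−1}` (`m ≥ 1`) and
`c_0 = (a_p − 2)·cneg` with `a_p − 2 ∈ ℤ_pˣ`, let `g` restrict to the topological generator, `n ≥ 1`, and let `z` be a functional on
`E(K_n·E)` with `p^{K} ∣ z(gʲ•c_n)` and `p^{K} ∣ z(gʲ•c_{n−1})` for all `j < pⁿ`. Then `p^{K} ∣ z(σ•c_m)` for all `σ ∈ Γ_E`, `m ≤ n`,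
and `p^{K} ∣ z(cneg)` (`Tr_{m+1/m} = ∑_{k<p} g^{p^m k}`, tree `Sprung2012.localTraceOfEmb_succ_eq_sum_pow_smul`).
[cite: Sprung2012, Thm. 2.2 (p. 1487) (the relations (1), (2))] [cite: Kobayashi2003, Lemma 8.9] -/
theorem pow_dvd_evalOn_orbit_of_relations {g : Field.absoluteGaloisGroup E} (hg : κ.IsTopGenerator (resGalOfEmb ι g)) {ap : ℤ}
    (hap : IsUnit ((ap - 2 : ℤ) : ℤ_[p])) {cneg : localPoints W E} {c : ℕ → localPoints W E}
    (hcneg : cneg ∈ localLayerPointsOfEmb κ ι W 0) (hc : ∀ n, c n ∈ localLayerPointsOfEmb κ ι W n)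
    (hR0 : c 0 = (ap - 2) • cneg)
    (hRn : ∀ m : ℕ, 1 ≤ m → localTraceOfEmb κ ι W m (m + 1) (c (m + 1)) = ap • c m - c (m - 1))
    {n : ℕ} (hn : 1 ≤ n) (K₀ : ℕ) (z : localLayerPointsOfEmb κ ι W n →+ ℤ_[p])
    (hzn : ∀ j < p ^ n, (p : ℤ_[p]) ^ K₀ ∣ evalOn W (localLayerPointsOfEmb κ ι W n) z (g ^ j • c n))
    (hzn1 : ∀ j < p ^ n, (p : ℤ_[p]) ^ K₀ ∣ evalOn W (localLayerPointsOfEmb κ ι W n) z (g ^ j • c (n - 1))) :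
    (∀ m ≤ n, ∀ σ : Field.absoluteGaloisGroup E,
      (p : ℤ_[p]) ^ K₀ ∣ evalOn W (localLayerPointsOfEmb κ ι W n) z (σ • c m)) ∧
    (p : ℤ_[p]) ^ K₀ ∣ evalOn W (localLayerPointsOfEmb κ ι W n) z cneg := by
  have hmono := localLayerPointsOfEmb_mono κ ι W
  -- all `Γ`-translates of `c_n`, `c_{n−1}` (cosets represented by powers of `g`)
  have horbn : ∀ σ : Field.absoluteGaloisGroup E, (p : ℤ_[p]) ^ K₀ ∣ evalOn W (localLayerPointsOfEmb κ ι W n) z (σ • c n) := by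
    intro σ
    obtain ⟨j, hj, hσ⟩ := exists_smul_eq_pow_smul κ ι W hg (hc n) σ
    rw [hσ]; exact hzn j hj
  have horbn1 : ∀ σ : Field.absoluteGaloisGroup E, (p : ℤ_[p]) ^ K₀ ∣ evalOn W (localLayerPointsOfEmb κ ι W n) z (σ • c (n - 1)) := by
    intro σ
    obtain ⟨j, hj, hσ⟩ := exists_smul_eq_pow_smul κ ι W hg (hmono (Nat.sub_le n 1) (hc (n - 1))) σ
    rw [hσ]; exact hzn1 j hj
  -- downward propagation: `σ•c_{m−1} = a_p σ•c_m − ∑_{k<p} (σ g^{p^m k})•c_{m+1}`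
  have hstep : ∀ m : ℕ, 1 ≤ m → m + 1 ≤ n →
      (∀ σ : Field.absoluteGaloisGroup E, (p : ℤ_[p]) ^ K₀ ∣ evalOn W (localLayerPointsOfEmb κ ι W n) z (σ • c (m + 1))) →
      (∀ σ : Field.absoluteGaloisGroup E, (p : ℤ_[p]) ^ K₀ ∣ evalOn W (localLayerPointsOfEmb κ ι W n) z (σ • c m)) →
      ∀ σ : Field.absoluteGaloisGroup E, (p : ℤ_[p]) ^ K₀ ∣ evalOn W (localLayerPointsOfEmb κ ι W n) z (σ • c (m - 1)) := by
    intro m hm hmn h1 h0 σ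
    have hrel : c (m - 1) = ap • c m - localTraceOfEmb κ ι W m (m + 1) (c (m + 1)) := by
      rw [hRn m hm]; abel
    have htr := localTraceOfEmb_succ_eq_sum_pow_smul κ ι W hg m (hc (m + 1))
    have hcm : σ • c m ∈ (localLayerPointsOfEmb κ ι W n) := hmono (by omega) (smul_mem_localLayerPointsOfEmb κ ι W m σ (hc m))
    have hterm : ∀ k ∈ range p, (σ * g ^ (p ^ m * k)) • c (m + 1) ∈ (localLayerPointsOfEmb κ ι W n) := fun k _ ↦
      hmono hmn (smul_mem_localLayerPointsOfEmb κ ι W (m + 1) _ (hc (m + 1)))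
    rw [hrel, smul_sub, htr, smul_sum, smul_comm σ ap (c m)]
    simp_rw [← mul_smul]
    rw [show ap • σ • c m - ∑ k ∈ range p, (σ * g ^ (p ^ m * k)) • c (m + 1) =
        ap • σ • c m + (-1 : ℤ) • ∑ k ∈ range p, (σ * g ^ (p ^ m * k)) • c (m + 1) by rw [neg_one_zsmul, sub_eq_add_neg],
      evalOn_add_mem W (localLayerPointsOfEmb κ ι W n) z (zsmul_mem hcm ap) (zsmul_mem ((localLayerPointsOfEmb κ ι W n).sum_mem hterm) _), evalOn_zsmul_mem W (localLayerPointsOfEmb κ ι W n) z hcm,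
      evalOn_zsmul_mem W (localLayerPointsOfEmb κ ι W n) z ((localLayerPointsOfEmb κ ι W n).sum_mem hterm), evalOn_sum_mem W (localLayerPointsOfEmb κ ι W n) z _ _ hterm]
    exact dvd_add ((h0 σ).mul_left _) ((dvd_sum fun k _ ↦ h1 _).mul_left _)
  -- induction on `i` for the pair of levels `(n − i, n − i − 1)`
  have hpair : ∀ i : ℕ, i + 1 ≤ n →
      (∀ σ : Field.absoluteGaloisGroup E, (p : ℤ_[p]) ^ K₀ ∣ evalOn W (localLayerPointsOfEmb κ ι W n) z (σ • c (n - i))) ∧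
      (∀ σ : Field.absoluteGaloisGroup E, (p : ℤ_[p]) ^ K₀ ∣ evalOn W (localLayerPointsOfEmb κ ι W n) z (σ • c (n - i - 1))) := by
    intro i
    induction i with
    | zero => intro _; exact ⟨by simpa using horbn, by simpa using horbn1⟩
    | succ i ih =>
      intro hi
      obtain ⟨h1, h0⟩ := ih (by omega)
      refine ⟨by simpa [Nat.sub_add_eq] using h0, ?_⟩
      have := hstep (n - i - 1) (by omega) (by omega) (by rwa [show n - i - 1 + 1 = n - i by omega]) h0
      rwa [show n - i - 1 - 1 = n - (i + 1) - 1 by omega] at this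
  have hall : ∀ m ≤ n, ∀ σ : Field.absoluteGaloisGroup E, (p : ℤ_[p]) ^ K₀ ∣ evalOn W (localLayerPointsOfEmb κ ι W n) z (σ • c m) := by
    intro m hm σ
    by_cases hmn : m = n
    · subst hmn; exact horbn σ
    · have := (hpair (n - m - 1) (by omega)).2 σ
      rwa [show n - (n - m - 1) - 1 = m by omega] at this
  refine ⟨hall, ?_⟩
  -- `cneg` from `c_0 = (a_p − 2)·cneg`
  have hcn : cneg ∈ (localLayerPointsOfEmb κ ι W n) := hmono (Nat.zero_le n) hcneg
  have h0 := hall 0 (Nat.zero_le n) 1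
  rw [one_smul, hR0, evalOn_zsmul_mem W (localLayerPointsOfEmb κ ι W n) z hcn] at h0
  exact hap.dvd_mul_left.mp h0

end SprungHonda

end Literature.NumberTheory.EllipticCurves.Sprung2012.Honda

end Part6

/-!
## Part 7 — port of `Summits/BirchSwinnertonDyer/BirchSwinnertonDyer/Theorems/PrintX8VSInputHondaSystemDualClauses.lean` (1 declarations kept)

# `IsHondaSystem` from the PRIMAL Honda data: the four dual generation clauses

(Port of the declarations listed in the Part header; the source module's docstring — cell bookkeeping of the BSD
printed-inputs programme — is abridged to its title here.)
-/

section Part7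

open scoped _root_.Classical
open _root_.Finset

universe u

namespace Literature.NumberTheory.EllipticCurves.Sprung2012.Honda

namespace SprungHonda

open Literature.NumberTheory.EllipticCurves Literature.NumberTheory.GaloisRepresentations
  Literature.NumberTheory.EllipticCurves.ZpExtension Literature.NumberTheory.EllipticCurves.Kobayashi2003
  Literature.NumberTheory.EllipticCurves.Sprung2012 Literature.NumberTheory.EllipticCurves.Sprung2017

variable {K : Type u} [Field K] {p : ℕ} [hp : Fact p.Prime] (κ : ZpExtension K p)
variable {E : Type u} [Field E] [Algebra K E] (ι : AlgebraicClosure K →ₐ[K] AlgebraicClosure E) (W : WeierstrassCurve K)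

/-- **`IsHondaSystem` from the primal Honda data.** [cite: Sprung2012, Thm. 2.2 (p. 1487) and Cor. 2.10 (p. 1489)]
[cite: Kobayashi2003, Prop. 8.12] -/
theorem isHondaSystem_of_primal {ap : ℤ} (hap : IsUnit ((ap - 2 : ℤ) : ℤ_[p])) {g : Field.absoluteGaloisGroup E}
    (hg : κ.IsTopGenerator (resGalOfEmb ι g)) {N : ℕ} (hN : N.Coprime p) {cneg : localPoints W E} {c : ℕ → localPoints W E}
    (hcneg : cneg ∈ localLayerPointsOfEmb κ ι W 0) (hc : ∀ n, c n ∈ localLayerPointsOfEmb κ ι W n)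
    (hR0 : c 0 = (ap - 2) • cneg)
    (hR1 : localTraceOfEmb κ ι W 0 1 (c 1) = ap • c 0 - ((p : ℤ) - 1) • cneg)
    (hRn : ∀ n : ℕ, 1 ≤ n → localTraceOfEmb κ ι W n (n + 1) (c (n + 1)) = ap • c n - c (n - 1))
    (hGEN : ∀ m : ℕ, 1 ≤ m → ∀ P ∈ localLayerPointsOfEmb κ ι W m,
      ∃ B ∈ AddSubgroup.closure (Set.range fun σ : Field.absoluteGaloisGroup E ↦ σ • c m),
        ∃ P' ∈ localLayerPointsOfEmb κ ι W (m - 1), ∃ R ∈ localLayerPointsOfEmb κ ι W m, N • P = B + P' + p • R)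
    (hGEN0 : ∀ P ∈ localLayerPointsOfEmb κ ι W 0,
      ∃ u : ℤ, ∃ R ∈ localLayerPointsOfEmb κ ι W 0, N • P = u • cneg + p • R) :
    IsHondaSystem κ ι W ap g cneg c := by
  -- the level-`0` engine: divisibility on `Γ·c_0 = {c_0}` and `cneg` suffices
  have hc0fix : ∀ σ : Field.absoluteGaloisGroup E, σ • c 0 = c 0 := (mem_localLayerPointsOfEmb_zero_iff κ ι W _).mp (hc 0)
  have core0 : ∀ (K₀ : ℕ) (z : localLayerPointsOfEmb κ ι W 0 →+ ℤ_[p]),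
      (p : ℤ_[p]) ^ K₀ ∣ evalOn W (localLayerPointsOfEmb κ ι W 0) z cneg →
      ∀ P ∈ localLayerPointsOfEmb κ ι W 0, (p : ℤ_[p]) ^ K₀ ∣ evalOn W (localLayerPointsOfEmb κ ι W 0) z P := by
    intro K₀ z hneg
    refine pow_dvd_evalOn_of_generation κ ι W hN hcneg hc hGEN hGEN0 0 K₀ z ?_ hneg
    intro m hm σ
    obtain rfl : m = 0 := Nat.le_zero.mp hm
    rw [hc0fix, hR0, evalOn_zsmul_mem W _ z hcneg]
    exact hneg.mul_left _
  -- the level-`n` engine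
  have coren : ∀ {n : ℕ}, 1 ≤ n → ∀ (K₀ : ℕ) (z : localLayerPointsOfEmb κ ι W n →+ ℤ_[p]),
      (∀ j < p ^ n, (p : ℤ_[p]) ^ K₀ ∣ evalOn W (localLayerPointsOfEmb κ ι W n) z (g ^ j • c n)) →
      (∀ j < p ^ n, (p : ℤ_[p]) ^ K₀ ∣ evalOn W (localLayerPointsOfEmb κ ι W n) z (g ^ j • c (n - 1))) →
      ∀ P ∈ localLayerPointsOfEmb κ ι W n, (p : ℤ_[p]) ^ K₀ ∣ evalOn W (localLayerPointsOfEmb κ ι W n) z P := by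
    intro n hn K₀ z hzn hzn1
    obtain ⟨horb, hneg⟩ := pow_dvd_evalOn_orbit_of_relations κ ι W hg hap hcneg hc hR0 hRn hn K₀ z hzn hzn1
    exact pow_dvd_evalOn_of_generation κ ι W hN hcneg hc hGEN hGEN0 n K₀ z horb hneg
  refine ⟨hcneg, hc, hR0, hR1, hRn, ?_, ?_, ?_, ?_⟩
  · -- level `0`, injectivity
    intro z hz
    ext ⟨P, hP⟩
    rw [AddMonoidHom.zero_apply]
    refine padicInt_eq_zero_of_forall_pow_dvd fun K₀ ↦ ?_
    have := core0 K₀ z (by rw [hz]; exact dvd_zero _) P hP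
    rwa [evalOn_of_mem W _ z hP] at this
  · -- level `0`, `p`-saturation
    rintro a ⟨z, hz⟩
    have hdiv : ∀ P : localLayerPointsOfEmb κ ι W 0, (p : ℤ_[p]) ∣ z P := by
      rintro ⟨P, hP⟩
      have := core0 1 z (by rw [hz, pow_one]; exact dvd_mul_right _ _) P hP
      rwa [pow_one, evalOn_of_mem W _ z hP] at this
    obtain ⟨y, rfl⟩ := exists_eq_smul_of_forall_dvd z hdiv
    refine ⟨y, ?_⟩
    have hp0 : (p : ℤ_[p]) ≠ 0 := by exact_mod_cast hp.out.ne_zero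
    apply mul_left_cancel₀ hp0
    rw [← hz, evalOn_of_mem W _ _ hcneg, evalOn_of_mem W _ _ hcneg, AddMonoidHom.smul_apply, smul_eq_mul]
  · -- level `n ≥ 1`, injectivity
    intro n hn z h1 h2
    rw [pairingSum_def] at h1 h2
    have e1 := forall_eq_zero_of_omega_dvd_sum h1
    have e2 := forall_eq_zero_of_omega_dvd_sum h2
    ext ⟨P, hP⟩
    rw [AddMonoidHom.zero_apply]
    refine padicInt_eq_zero_of_forall_pow_dvd fun K₀ ↦ ?_
    have := coren hn K₀ z (fun j hj ↦ by rw [e1 j hj]; exact dvd_zero _) (fun j hj ↦ by rw [e2 j hj]; exact dvd_zero _) P hP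
    rwa [evalOn_of_mem W _ z hP] at this
  · -- level `n ≥ 1`, `p`-torsion-free cokernel
    rintro n hn a b ⟨z, ha, hb⟩
    rw [pairingSum_def] at ha hb
    have d1 := forall_dvd_of_omega_dvd_C_mul_sub_sum ha
    have d2 := forall_dvd_of_omega_dvd_C_mul_sub_sum hb
    have hdiv : ∀ P : localLayerPointsOfEmb κ ι W n, (p : ℤ_[p]) ∣ z P := by
      rintro ⟨P, hP⟩
      have := coren hn 1 z (fun j hj ↦ by rw [pow_one]; exact d1 j hj) (fun j hj ↦ by rw [pow_one]; exact d2 j hj) P hP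
      rwa [pow_one, evalOn_of_mem W _ z hP] at this
    obtain ⟨y, rfl⟩ := exists_eq_smul_of_forall_dvd z hdiv
    refine ⟨y, ?_, ?_⟩
    · refine omega_dvd_of_omega_dvd_C_mul ?_
      rw [mul_sub, ← pairingSum_smul, pairingSum_def]
      exact ha
    · refine omega_dvd_of_omega_dvd_C_mul ?_
      rw [mul_sub, ← pairingSum_smul, pairingSum_def]
      exact hb

end SprungHonda

end Literature.NumberTheory.EllipticCurves.Sprung2012.Honda

end Part7

/-! ## Part 8 — the EXACT discharge of `Sprung2012.thm22_exists_isHondaSystem` -/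

namespace Literature.NumberTheory.EllipticCurves.Sprung2012

open scoped Classical NumberField in
open NumberField IsDedekindDomain Literature.NumberTheory.EllipticCurves Literature.NumberTheory.GaloisRepresentations
  Literature.NumberTheory.EllipticCurves.Kobayashi2003 Honda in
/-- **The named fact `thm22_exists_isHondaSystem` HOLDS — Sprung 2012, Theorem 2.2** (`ColemanMapTheorems.lean`): for `W/ℚ` elliptic
and globally minimal, `p ≠ 2` of good reduction with `p ∣ a_p`, a cyclotomic `κ` with topological generator `γ`, the place `v ∋ p`
and a local lift `g` of the generator, there are `cneg = c_{−1} ∈ E(ℚ_v)` and `c = (c_n)_n` with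
`IsHondaSystem κ (closureEmb ℚ_v) W a_p g cneg c` — the primal Honda data over `ℚ_[p]` (`SprungHonda.exists_primalHonda_padic`),
transported to `ℚ_v` (`SprungHonda.primalHonda_adicCompletion_of_padic`) and dualised (`SprungHonda.isHondaSystem_of_primal`).  EXACT
discharge, Literature-side twin of `Summit.BirchSwinnertonDyer.BirchSwinnertonDyer.Theorems.thm22_exists_isHondaSystem_holds` (same proof).
[cite: Sprung2012, Thm. 2.2 (p. 1487), Cor. 2.10 (p. 1489)] [cite: Kobayashi2003, Lemma 8.9, Prop. 8.11, Prop. 8.12] -/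
theorem thm22_exists_isHondaSystem_holds : thm22_exists_isHondaSystem := by
  intro W _ _ p _ hp2 hgood hap κ γ hκ _ _ v hv g hg
  obtain ⟨cneg, c, N, hN, hcneg, hc, hR0, hR1, hRn, hGEN, hGEN0⟩ :=
    SprungHonda.primalHonda_adicCompletion_of_padic W κ (W.frobeniusTrace p) v hv
      (fun ι ↦ SprungHonda.exists_primalHonda_padic W hp2 hgood hap κ hκ ι)
  exact ⟨cneg, c, SprungHonda.isHondaSystem_of_primal κ (closureEmb (K := ℚ) (v.adicCompletion ℚ)) W
    (SprungHonda.intCast_sub_two_isUnit_of_dvd hp2 hap).2 hg hN hcneg hc hR0 hR1 hRn hGEN hGEN0⟩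

end Literature.NumberTheory.EllipticCurves.Sprung2012

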